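import Mathlib.Analysis.Calculus.BumpFunction.InnerProduct
import Mathlib.Analysis.Calculus.BumpFunction.Normed
import Mathlib.Analysis.Calculus.MeanValue
import Mathlib.Analysis.SpecialFunctions.JapaneseBracket
import Mathlib.Analysis.SpecialFunctions.Pow.Deriv
import Mathlib.Analysis.PSeries
import Mathlib.Analysis.Complex.ExponentialBounds
import Literature.Analysis.Fourier.FractalUncertaintyPrincipleProofs
import HarnessLib

/-!
# Bourgain–Dyatlov 2018, §3.1: the weight adapted to a regular set, and Lemma 3.1 from Lemma 2.11

Analysis/Fourier proof file; companion to `FractalUncertaintyPrinciple` (the named fact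
`Literature.Analysis.Fourier.bourgainDyatlov2018_thm4`, J. Bourgain–S. Dyatlov, *Spectral gaps
without the pressure condition*, Ann. of Math. 187 (2018), Theorem 4) and to
`FractalUncertaintyPrincipleProofs` (regular-set combinatorics of BD18 §2.2). Theorem 4 is
deduced in BD18 §3.4 from the unique-continuation estimate Proposition 3.3, which in turn rests
(§3.3) on two inputs: Lemma 3.1 (a compactly supported multiplier `ψ` whose Fourier transform
decays like `exp(-c θ(ξ)|ξ|)` on the regular set `Y`) and Lemma 3.2 (harmonic-measure
interpolation). Lemma 3.1 = (an explicit weight `ω` adapted to `Y`, (3.6)–(3.9)) + (the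
quantitative Beurling–Malliavin theorem, BD18 Lemma 2.11, from BD18 Theorem 5). This file
PROVES, sorry-free, everything in that chain except the Beurling–Malliavin input:

* `IsRegularSet.small_cover` — BD18 Lemma 2.8 ("The small cover property"), constant `6 C_R²`.
* `exists_cutoff`, `scaled_cutoff`, `contDiff_scaled_cutoff`, `deriv_cutoff_eq_zero_of_far` —
  the `C¹` cutoffs `χ`, `χ_J` of §3.1; `dyadicScale_bounds` — `2 ≤ ρ_n ≤ 2^n` for
  `ρ_n = n^{-(1+δ)/2} 2^n`; `theta_mul_le_dyadic` — `θ(ξ)|ξ| ≤ 4ρ_n` on `A_n`.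
* `exists_dyadic_generation` — the cells `𝒥_n` of one generation (cover of `Y ∩ A_n`,
  `#𝒥_n ≤ 6 C_R² (2^n/ρ_n)^δ`, and the localisation of doubled cells for `n ≥ 16`);
  `sum_abs_deriv_cutoff_le`, `sum_integral_cutoff_div_le`, `generation_integral_le`,
  `card_filter_near_le_three`, `card_filter_dyadic_le_three` — the overlap and integral
  bookkeeping ("each `ξ` lies in at most 500 intervals `J̃`"; `Σ N_n 2^{-2n} ρ_n² < ∞`);
  `deriv_japaneseBracket_quarter`, `contDiff_japaneseBracket_quarter`,
  `integrable_japaneseBracket_quarter_div` — the smooth part `2⟨ξ⟩^{1/2}`.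
* `exists_adapted_weight` — **the weight of BD18 (3.7)** in the form `Ω = -log ω`: for
  `0 < δ < 1`, `C_R ≥ 1` a constant `C₀(δ, C_R)` such that every `δ`-regular `Y ⊂ [-α₁, α₁]`
  (scales `2` to `α₁`) has `Ω ∈ C¹`, `Ω ≥ 2⟨ξ⟩^{1/2}`, `|Ω'| ≤ C₀`, `∫ Ω/(1+ξ²) ≤ C₀`
  ((2.6)–(2.7), (3.8)) and `Ω ≥ θ(ξ)|ξ|` on `Y` ((3.9)).
* `adapted_multiplier_of_quantitativeBM` — **BD18 Lemma 3.1 from BD18 Lemma 2.11**: with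
  Lemma 2.11 as an explicit hypothesis (stated for `C¹` weights `ω = e^{-Ω}` as printed), the
  conclusions (3.2)–(3.5) of Lemma 3.1 follow, with `c₂` depending only on `δ, C_R, c₁`.

Deliberately NOT here: BD18 Theorem 5 (Beurling–Malliavin) and the compactness argument of
Lemma 2.11 (no Mathlib support for the multiplier theorem); Lemma 3.2 and §2.4 (harmonic
measure); Proposition 3.3 and Lemma 3.4 (§3.3). Constants are not optimised (`6` for `12`,
an abstract derivative bound `K` for the printed `sup|∂χ| ≤ 10`, `18 · 6K` for `500`).
-/

namespace Literature.Analysis.Fourier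

open _root_.MeasureTheory Set
open scoped ENNReal NNReal FourierTransform

/-- **The small cover property** (BD18 Lemma 2.8, constant `6 C_R²` instead of the printed
`12 C_R²`): let `X` be `δ`-regular with constant `C_R` on scales `α₀` to `α₁`, and let
`[a, b]` be an interval and `ρ > 0` a size with `α₀ ≤ ρ ≤ b - a ≤ α₁`. Then the grid cells
`[jρ, (j+1)ρ]` meeting `X ∩ [a, b]` — a nonoverlapping collection of intervals of size `ρ`
covering `X ∩ [a, b]` — are at most `6 C_R² ((b-a)/ρ)^δ` in number. Proof as printed (§2.2):
each such cell carries an interval of size `ρ` centred in `X`, of mass `≥ C_R⁻¹ρ^δ`, all inside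
`[a - ρ/2, b + ρ/2]`, which two intervals of size `b - a` cover; conclude with the counting lemma
`card_mul_le_of_centred_intervals`. [cite: BourgainDyatlov2018, Lemma 2.8] -/
theorem IsRegularSet.small_cover {X : Set ℝ} {δ C_R α₀ α₁ : ℝ}
    (hX : IsRegularSet X δ C_R α₀ α₁) (hC : 0 < C_R) {a b ρ : ℝ} (hρ : 0 < ρ) (h₀ : α₀ ≤ ρ)
    (hρI : ρ ≤ b - a) (h₁ : b - a ≤ α₁) :
    ∃ S : Finset ℤ, (X ∩ Icc a b ⊆ ⋃ j ∈ S, Icc ((j : ℝ) * ρ) ((j + 1) * ρ)) ∧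
      (∀ j ∈ S, (X ∩ Icc a b ∩ Icc ((j : ℝ) * ρ) ((j + 1) * ρ)).Nonempty) ∧
      (S.card : ℝ) ≤ 6 * C_R ^ 2 * ((b - a) / ρ) ^ δ := by
  classical
  obtain ⟨-, -, μ, -, hreg⟩ := hX
  have hba : 0 < b - a := hρ.trans_le hρI
  -- the cells meeting `X ∩ [a,b]`, indexed inside a finite window
  set T : Finset ℤ := Finset.Icc ⌊a / ρ⌋ ⌊b / ρ⌋ with hT
  set S : Finset ℤ := T.filter fun j => (X ∩ Icc a b ∩ Icc ((j : ℝ) * ρ) ((j + 1) * ρ)).Nonempty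
    with hS
  refine ⟨S, ?_, fun j hj => (Finset.mem_filter.1 hj).2, ?_⟩
  · intro x hx
    have hxJ : x ∈ Icc ((⌊x / ρ⌋ : ℝ) * ρ) ((⌊x / ρ⌋ + 1) * ρ) := by
      constructor
      · have := Int.floor_le (x / ρ)
        rwa [le_div_iff₀ hρ] at this
      · have := Int.lt_floor_add_one (x / ρ)
        rw [div_lt_iff₀ hρ] at this
        exact this.le
    have hjT : ⌊x / ρ⌋ ∈ T := by
      rw [hT, Finset.mem_Icc]
      exact ⟨Int.floor_mono (div_le_div_of_nonneg_right hx.2.1 hρ.le),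
        Int.floor_mono (div_le_div_of_nonneg_right hx.2.2 hρ.le)⟩
    have hjS : ⌊x / ρ⌋ ∈ S := by
      rw [hS, Finset.mem_filter]
      exact ⟨hjT, x, hx, hxJ⟩
    exact Set.mem_iUnion₂.2 ⟨⌊x / ρ⌋, hjS, hxJ⟩
  · -- counting
    have hc : ∀ j ∈ S, ∃ x, x ∈ X ∩ Icc a b ∧ x ∈ Icc ((j : ℝ) * ρ) ((j + 1) * ρ) := by
      intro j hj
      obtain ⟨x, hx⟩ := (Finset.mem_filter.1 hj).2
      exact ⟨x, hx.1, hx.2⟩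
    choose! c hcX hcJ using hc
    set E : Set ℝ := Icc (a - ρ / 2) (a - ρ / 2 + (b - a)) ∪ Icc (b + ρ / 2 - (b - a)) (b + ρ / 2)
      with hE
    have hμE : μ E ≤ ENNReal.ofReal (2 * (C_R * (b - a) ^ δ)) := by
      have h1 := (hreg (a - ρ / 2) (a - ρ / 2 + (b - a)) (by linarith) (by linarith)
        (by linarith)).1
      have h2 := (hreg (b + ρ / 2 - (b - a)) (b + ρ / 2) (by linarith) (by linarith)
        (by linarith)).1
      have e1 : a - ρ / 2 + (b - a) - (a - ρ / 2) = b - a := by ring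
      have e2 : b + ρ / 2 - (b + ρ / 2 - (b - a)) = b - a := by ring
      rw [e1] at h1
      rw [e2] at h2
      calc μ E ≤ μ (Icc (a - ρ / 2) (a - ρ / 2 + (b - a))) +
            μ (Icc (b + ρ / 2 - (b - a)) (b + ρ / 2)) := measure_union_le _ _
        _ ≤ ENNReal.ofReal (C_R * (b - a) ^ δ) + ENNReal.ofReal (C_R * (b - a) ^ δ) :=
            add_le_add h1 h2
        _ = ENNReal.ofReal (2 * (C_R * (b - a) ^ δ)) := by
            rw [← ENNReal.ofReal_add (by positivity) (by positivity), two_mul]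
    have hcount := card_mul_le_of_centred_intervals (μ := μ) (S := S) (c := c) (p := 0) (w := ρ)
      (m := C_R⁻¹ * ρ ^ δ) (B := 2 * (C_R * (b - a) ^ δ)) (E := E) hρ (by positivity)
      (fun j hj => ⟨by simpa using (hcJ j hj).1, by simpa using (hcJ j hj).2⟩)
      (fun j hj => by
        have h := (hreg (c j - ρ / 2) (c j + ρ / 2) (by linarith) (by linarith) (by linarith)).2
        have e1 : c j + ρ / 2 - (c j - ρ / 2) = ρ := by ring
        have e2 : (c j - ρ / 2 + (c j + ρ / 2)) / 2 = c j := by ring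
        rw [e1, e2] at h
        exact h (hcX j hj).1)
      (fun j hj => by
        have hcab := (hcX j hj).2
        intro x hx
        have hx1 : a - ρ / 2 ≤ x := by linarith [hx.1, hcab.1]
        have hx2 : x ≤ b + ρ / 2 := by linarith [hx.2, hcab.2]
        by_cases hxm : x ≤ a - ρ / 2 + (b - a)
        · exact Or.inl ⟨hx1, hxm⟩
        · exact Or.inr ⟨by push Not at hxm; linarith, hx2⟩)
      hμE
    have hρδ : 0 < ρ ^ δ := Real.rpow_pos_of_pos hρ δ
    have h : (S.card : ℝ) * (C_R⁻¹ * ρ ^ δ) * (C_R * (ρ ^ δ)⁻¹) ≤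
        3 * (2 * (C_R * (b - a) ^ δ)) * (C_R * (ρ ^ δ)⁻¹) :=
      mul_le_mul_of_nonneg_right hcount (by positivity)
    have e1 : (S.card : ℝ) * (C_R⁻¹ * ρ ^ δ) * (C_R * (ρ ^ δ)⁻¹) = S.card := by
      field_simp
    have e2 : 3 * (2 * (C_R * (b - a) ^ δ)) * (C_R * (ρ ^ δ)⁻¹) =
        6 * C_R ^ 2 * ((b - a) / ρ) ^ δ := by
      rw [Real.div_rpow hba.le hρ.le]
      field_simp
      ring
    rwa [e1, e2] at h


/-- **A `C¹` cutoff** (BD18 §3.1: "Fix a cutoff function `χ ∈ C¹(ℝ; [0,1])`, `sup |∂χ| ≤ 10`,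
`supp χ ⊂ [-1,1]`, `χ = 1` on `[-1/2, 1/2]`"): there is a differentiable `χ : ℝ → [0, 1]` with
`χ = 1` on `[-1/2, 1/2]`, `χ = 0` off `(-1, 1)` and `|χ'| ≤ K` for some constant `K` (we do
not insist on `K = 10`). From Mathlib's smooth bump functions. [cite: BourgainDyatlov2018, §3.1] -/
theorem exists_cutoff : ∃ χ : ℝ → ℝ, ContDiff ℝ 1 χ ∧ Differentiable ℝ χ ∧ (∀ x, 0 ≤ χ x) ∧
    (∀ x, χ x ≤ 1) ∧ (∀ x, |x| ≤ 1 / 2 → χ x = 1) ∧ (∀ x, 1 ≤ |x| → χ x = 0) ∧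
    ∃ K : ℝ, 0 ≤ K ∧ ∀ x, |deriv χ x| ≤ K := by
  let b : ContDiffBump (0 : ℝ) := ⟨1 / 2, 1, by norm_num, by norm_num⟩
  have hcd : ContDiff ℝ 1 (b : ℝ → ℝ) := b.contDiff
  have hdiff : Differentiable ℝ (b : ℝ → ℝ) := hcd.differentiable one_ne_zero
  have hderiv_cont : Continuous (deriv (b : ℝ → ℝ)) := hcd.continuous_deriv le_rfl
  have hderiv_supp : HasCompactSupport (deriv (b : ℝ → ℝ)) := b.hasCompactSupport.deriv
  obtain ⟨K, hK⟩ := hderiv_cont.bounded_above_of_compact_support hderiv_supp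
  refine ⟨b, hcd, hdiff, fun x => b.nonneg, fun x => b.le_one, fun x hx => ?_, fun x hx => ?_,
    K, (norm_nonneg _).trans (hK 0), fun x => ?_⟩
  · refine b.one_of_mem_closedBall ?_
    rw [Metric.mem_closedBall, Real.dist_eq, sub_zero]
    exact hx
  · refine b.zero_of_le_dist ?_
    rw [Real.dist_eq, sub_zero]
    exact hx
  · have := hK x
    rwa [Real.norm_eq_abs] at this

/-- The scaled cutoff `χ_J(ξ) = |J| χ((ξ - ξ_J)/|J|)` of BD18 §3.1 for an interval `J` of size
`ρ > 0` and centre `m`: it equals `ρ` on `J = [m - ρ/2, m + ρ/2]`, vanishes off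
`J̃ = (m - ρ, m + ρ)`, takes values in `[0, ρ]`, and is differentiable with `|∂χ_J| ≤ K`.
[cite: BourgainDyatlov2018, §3.1] -/
theorem scaled_cutoff {χ : ℝ → ℝ} (hχd : Differentiable ℝ χ) (hχ0 : ∀ x, 0 ≤ χ x)
    (hχ1 : ∀ x, χ x ≤ 1) (hχone : ∀ x, |x| ≤ 1 / 2 → χ x = 1) (hχzero : ∀ x, 1 ≤ |x| → χ x = 0)
    {K : ℝ} (hK : ∀ x, |deriv χ x| ≤ K) {ρ : ℝ} (hρ : 0 < ρ) (m : ℝ) :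
    (Differentiable ℝ fun ξ => ρ * χ ((ξ - m) / ρ)) ∧
    (∀ ξ, 0 ≤ ρ * χ ((ξ - m) / ρ)) ∧ (∀ ξ, ρ * χ ((ξ - m) / ρ) ≤ ρ) ∧
    (∀ ξ, |ξ - m| ≤ ρ / 2 → ρ * χ ((ξ - m) / ρ) = ρ) ∧
    (∀ ξ, ρ ≤ |ξ - m| → ρ * χ ((ξ - m) / ρ) = 0) ∧
    (∀ ξ, |deriv (fun ξ => ρ * χ ((ξ - m) / ρ)) ξ| ≤ K) := by
  have haff : ∀ ξ, HasDerivAt (fun ξ => (ξ - m) / ρ) ρ⁻¹ ξ := fun ξ => by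
    simpa [div_eq_mul_inv] using ((hasDerivAt_id ξ).sub_const m).mul_const ρ⁻¹
  have hcomp : ∀ ξ, HasDerivAt (fun ξ => ρ * χ ((ξ - m) / ρ))
      (ρ * (deriv χ ((ξ - m) / ρ) * ρ⁻¹)) ξ := fun ξ =>
    (((hχd _).hasDerivAt).comp ξ (haff ξ)).const_mul ρ
  refine ⟨fun ξ => (hcomp ξ).differentiableAt, fun ξ => mul_nonneg hρ.le (hχ0 _),
    fun ξ => mul_le_of_le_one_right hρ.le (hχ1 _), fun ξ hξ => ?_, fun ξ hξ => ?_, fun ξ => ?_⟩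
  · rw [hχone _ (by rw [abs_div, abs_of_pos hρ, div_le_iff₀ hρ]; linarith), mul_one]
  · rw [hχzero _ (by rw [abs_div, abs_of_pos hρ, le_div_iff₀ hρ]; linarith), mul_zero]
  · rw [(hcomp ξ).deriv]
    have : ρ * (deriv χ ((ξ - m) / ρ) * ρ⁻¹) = deriv χ ((ξ - m) / ρ) := by field_simp
    rw [this]
    exact hK _

/-- The scaled cutoff `χ_J` is `C¹` when `χ` is. [cite: BourgainDyatlov2018, §3.1] -/
theorem contDiff_scaled_cutoff {χ : ℝ → ℝ} (hχ : ContDiff ℝ 1 χ) (ρ m : ℝ) :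
    ContDiff ℝ 1 fun ξ => ρ * χ ((ξ - m) / ρ) :=
  contDiff_const.mul (hχ.comp ((contDiff_id.sub contDiff_const).div_const ρ))

/-- The dyadic scales `ρ_n = n^{-(1+δ)/2} 2^n` of BD18 §3.1 satisfy `2 ≤ ρ_n ≤ 2^n` for `n ≥ 1`,
`0 ≤ δ ≤ 1`. [cite: BourgainDyatlov2018, §3.1] -/
theorem dyadicScale_bounds {δ : ℝ} (hδ0 : 0 ≤ δ) (hδ1 : δ ≤ 1) {n : ℕ} (hn : 1 ≤ n) :
    2 ≤ (n : ℝ) ^ (-(1 + δ) / 2) * 2 ^ n ∧ (n : ℝ) ^ (-(1 + δ) / 2) * 2 ^ n ≤ 2 ^ n := by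
  have hn' : (1 : ℝ) ≤ n := by exact_mod_cast hn
  have hnpos : (0 : ℝ) < n := by positivity
  have hexp : -(1 + δ) / 2 ≤ 0 := by linarith
  have h1 : (n : ℝ) ^ (-(1 + δ) / 2) ≤ 1 := Real.rpow_le_one_of_one_le_of_nonpos hn' hexp
  constructor
  · -- `2^n ≥ 2n` and `n^{-(1+δ)/2} · n = n^{(1-δ)/2} ≥ 1`
    have hB : n ≤ 2 ^ (n - 1) := by
      have h := Nat.succ_le_of_lt (Nat.lt_two_pow_self (n := n - 1))
      rwa [Nat.succ_eq_add_one, Nat.sub_add_cancel hn] at h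
    have hB' : (n : ℝ) ≤ 2 ^ (n - 1) := by exact_mod_cast hB
    have hpow : (2 : ℝ) ^ n = 2 * 2 ^ (n - 1) := by
      conv_lhs => rw [show n = (n - 1) + 1 by omega, pow_succ]
      ring
    have h2n : 2 * (n : ℝ) ≤ 2 ^ n := by rw [hpow]; linarith
    have hprod : (n : ℝ) ^ (-(1 + δ) / 2) * n = (n : ℝ) ^ ((1 - δ) / 2) := by
      conv_lhs => rw [← Real.rpow_one (n : ℝ), ← Real.rpow_mul hnpos.le, one_mul]
      rw [← Real.rpow_add hnpos]
      congr 1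
      ring
    have hge1 : (1 : ℝ) ≤ (n : ℝ) ^ ((1 - δ) / 2) := Real.one_le_rpow hn' (by linarith)
    calc (2 : ℝ) ≤ 2 * (n : ℝ) ^ ((1 - δ) / 2) := by linarith
      _ = (n : ℝ) ^ (-(1 + δ) / 2) * (2 * n) := by rw [← hprod]; ring
      _ ≤ (n : ℝ) ^ (-(1 + δ) / 2) * 2 ^ n := mul_le_mul_of_nonneg_left h2n (by positivity)
  · calc (n : ℝ) ^ (-(1 + δ) / 2) * 2 ^ n ≤ 1 * 2 ^ n :=
        mul_le_mul_of_nonneg_right h1 (by positivity)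
      _ = 2 ^ n := one_mul _


/-- Per-cell integral bound for the weight of BD18 §3.1: a continuous `0 ≤ B ≤ ρ` vanishing off
`(m - ρ, m + ρ)`, all of whose support points satisfy `|ξ| ≥ R`, has
`∫ B(ξ)/(1+ξ²) dξ ≤ 2ρ² / (1 + R²)` (only `B ≤ ρ` is used).
[cite: BourgainDyatlov2018, §3.1, proof of Lemma 3.1] -/
theorem integral_bump_div_le {B : ℝ → ℝ} {m ρ R : ℝ} (hρ : 0 < ρ) (hR : 0 ≤ R)
    (hcont : Continuous B) (hB1 : ∀ ξ, B ξ ≤ ρ)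
    (hsupp : ∀ ξ, ρ ≤ |ξ - m| → B ξ = 0) (hfar : ∀ ξ, |ξ - m| < ρ → R ≤ |ξ|) :
    Integrable (fun ξ => B ξ / (1 + ξ ^ 2)) ∧
      ∫ ξ, B ξ / (1 + ξ ^ 2) ≤ 2 * ρ * (ρ / (1 + R ^ 2)) := by
  have hcont' : Continuous fun ξ => B ξ / (1 + ξ ^ 2) :=
    hcont.div (continuous_const.add (continuous_id.pow 2)) fun ξ => by positivity
  have hcs : HasCompactSupport fun ξ => B ξ / (1 + ξ ^ 2) := by
    refine HasCompactSupport.intro (isCompact_Icc (a := m - ρ) (b := m + ρ)) fun ξ hξ => ?_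
    rw [hsupp ξ ?_, zero_div]
    rw [Set.mem_Icc, not_and_or, not_le, not_le] at hξ
    rcases hξ with h | h
    · rw [abs_of_neg (by linarith)]; linarith
    · rw [abs_of_pos (by linarith)]; linarith
  have hint : Integrable (fun ξ => B ξ / (1 + ξ ^ 2)) := hcont'.integrable_of_hasCompactSupport hcs
  refine ⟨hint, ?_⟩
  -- pointwise bound by `ρ/(1+R²)` on `[m - ρ, m + ρ]`, zero outside
  have hpt : ∀ ξ, B ξ / (1 + ξ ^ 2) ≤ (Icc (m - ρ) (m + ρ)).indicator (fun _ => ρ / (1 + R ^ 2)) ξ := by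
    intro ξ
    by_cases hξ : |ξ - m| < ρ
    · have hmem : ξ ∈ Icc (m - ρ) (m + ρ) := by
        rw [abs_lt] at hξ; constructor <;> linarith [hξ.1, hξ.2]
      rw [Set.indicator_of_mem hmem]
      have hRξ := hfar ξ hξ
      have h1 : 1 + R ^ 2 ≤ 1 + ξ ^ 2 := by nlinarith [sq_abs ξ, abs_nonneg ξ]
      calc B ξ / (1 + ξ ^ 2) ≤ ρ / (1 + ξ ^ 2) :=
            div_le_div_of_nonneg_right (hB1 ξ) (by positivity)
        _ ≤ ρ / (1 + R ^ 2) := div_le_div_of_nonneg_left hρ.le (by positivity) h1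
    · push Not at hξ
      rw [hsupp ξ hξ, zero_div]
      exact Set.indicator_nonneg (fun _ _ => by positivity) ξ
  calc ∫ ξ, B ξ / (1 + ξ ^ 2)
      ≤ ∫ ξ, (Icc (m - ρ) (m + ρ)).indicator (fun _ => ρ / (1 + R ^ 2)) ξ := by
        refine integral_mono hint ?_ hpt
        have hfin : IsFiniteMeasure (volume.restrict (Icc (m - ρ) (m + ρ))) := by
          rw [isFiniteMeasure_restrict]; exact measure_Icc_lt_top.ne
        have hI : IntegrableOn (fun _ : ℝ => ρ / (1 + R ^ 2)) (Icc (m - ρ) (m + ρ)) :=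
          integrable_const _
        exact hI.integrable_indicator measurableSet_Icc
    _ = 2 * ρ * (ρ / (1 + R ^ 2)) := by
        rw [integral_indicator measurableSet_Icc, setIntegral_const, smul_eq_mul,
          Real.volume_real_Icc_of_le (by linarith)]
        ring

/-- At most three consecutive-grid centres are within `ρ` of a point: the integers `j` with
`|ξ - (j + 1/2)ρ| ≤ ρ` number at most `3`. [folklore] -/
theorem card_filter_near_le_three (S : Finset ℤ) {ρ : ℝ} (hρ : 0 < ρ) (ξ : ℝ) :
    (S.filter fun j : ℤ => |ξ - (j + 1 / 2) * ρ| ≤ ρ).card ≤ 3 := by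
  have hsub : (S.filter fun j : ℤ => |ξ - (j + 1 / 2) * ρ| ≤ ρ) ⊆
      Finset.Icc (⌈ξ / ρ - 3 / 2⌉) (⌊ξ / ρ + 1 / 2⌋) := by
    intro j hj
    rw [Finset.mem_filter] at hj
    have h := hj.2
    rw [abs_le] at h
    rw [Finset.mem_Icc, Int.ceil_le, Int.le_floor]
    constructor
    · have h3 : ξ ≤ ((j : ℝ) + 3 / 2) * ρ := by nlinarith [h.2]
      have h4 : ξ / ρ ≤ (j : ℝ) + 3 / 2 := (div_le_iff₀ hρ).2 h3
      linarith
    · have h3 : ((j : ℝ) - 1 / 2) * ρ ≤ ξ := by nlinarith [h.1]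
      have h4 : (j : ℝ) - 1 / 2 ≤ ξ / ρ := (le_div_iff₀ hρ).2 h3
      linarith
  refine (Finset.card_le_card hsub).trans ?_
  rw [Int.card_Icc]
  have : ⌊ξ / ρ + 1 / 2⌋ + 1 - ⌈ξ / ρ - 3 / 2⌉ ≤ 3 := by
    have h1 : (⌊ξ / ρ + 1 / 2⌋ : ℝ) ≤ ξ / ρ + 1 / 2 := Int.floor_le _
    have h2 : ξ / ρ - 3 / 2 ≤ ⌈ξ / ρ - 3 / 2⌉ := Int.le_ceil _
    have : (⌊ξ / ρ + 1 / 2⌋ : ℝ) - ⌈ξ / ρ - 3 / 2⌉ ≤ 2 := by linarith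
    have : ⌊ξ / ρ + 1 / 2⌋ - ⌈ξ / ρ - 3 / 2⌉ ≤ 2 := by exact_mod_cast this
    omega
  omega

/-- At most three dyadic generations see a given point: the naturals `n` with
`2^{n-1} ≤ |ξ| < 2^{n+2}` number at most `3`. [folklore] -/
theorem card_filter_dyadic_le_three (F : Finset ℕ) (ξ : ℝ) :
    (F.filter fun n : ℕ => (2 : ℝ) ^ n / 2 ≤ |ξ| ∧ |ξ| < 2 ^ n * 4).card ≤ 3 := by
  set G := F.filter fun n : ℕ => (2 : ℝ) ^ n / 2 ≤ |ξ| ∧ |ξ| < 2 ^ n * 4 with hG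
  by_cases hne : G.Nonempty
  · obtain ⟨m, hm⟩ := G.min_of_nonempty hne
    have hmG := Finset.mem_of_min hm
    have key : ∀ n ∈ G, n ≤ m + 2 := by
      intro n hn
      have hn' := (Finset.mem_filter.1 hn).2
      have hm' := (Finset.mem_filter.1 hmG).2
      -- `2^n / 2 ≤ |ξ| < 2^m · 4` forces `n ≤ m + 2`
      by_contra hlt
      push Not at hlt
      have : (2 : ℝ) ^ (m + 3) ≤ 2 ^ n := pow_le_pow_right₀ (by norm_num) (by omega)
      have h8 : (2 : ℝ) ^ (m + 3) = 2 ^ m * 8 := by rw [pow_add]; norm_num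
      linarith [hn'.1, hm'.2]
    have hsub : G ⊆ Finset.Icc m (m + 2) := by
      intro n hn
      rw [Finset.mem_Icc]
      exact ⟨Finset.min_le_of_eq hn hm, key n hn⟩
    refine (Finset.card_le_card hsub).trans ?_
    rw [Nat.card_Icc]
    omega
  · rw [Finset.not_nonempty_iff_eq_empty] at hne
    rw [hne]; simp

/-- The decay rate `θ(ξ)|ξ|` against the dyadic scale (BD18 §3.1, the step from (3.7) to
(3.9)): for `s ∈ [1/2, 1]`, `n ≥ 1` and `2^n ≤ |ξ| < 2^{n+1}`,
`log(10 + |ξ|)^{-s} |ξ| ≤ 4 n^{-s} 2^n`. [cite: BourgainDyatlov2018, §3.1, (3.9)] -/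
theorem theta_mul_le_dyadic {s : ℝ} (hs0 : 1 / 2 ≤ s) (hs1 : s ≤ 1) {n : ℕ} (hn : 1 ≤ n)
    {ξ : ℝ} (h1 : (2 : ℝ) ^ n ≤ |ξ|) (h2 : |ξ| < 2 ^ (n + 1)) :
    Real.log (10 + |ξ|) ^ (-s) * |ξ| ≤ 4 * ((n : ℝ) ^ (-s) * 2 ^ n) := by
  have hn' : (1 : ℝ) ≤ n := by exact_mod_cast hn
  have hlog2 : (1 : ℝ) / 2 < Real.log 2 := by
    have := Real.log_two_gt_d9; linarith
  -- `log (10 + |ξ|) ≥ n log 2 ≥ n / 2`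
  have hlog : (n : ℝ) / 2 ≤ Real.log (10 + |ξ|) := by
    have h2n : (0 : ℝ) < 2 ^ n := by positivity
    have hle : Real.log (2 ^ n) ≤ Real.log (10 + |ξ|) :=
      Real.log_le_log h2n (by linarith)
    rw [Real.log_pow] at hle
    nlinarith
  have hnpos : (0 : ℝ) < n / 2 := by positivity
  have hθ : Real.log (10 + |ξ|) ^ (-s) ≤ ((n : ℝ) / 2) ^ (-s) :=
    Real.rpow_le_rpow_of_nonpos hnpos hlog (by linarith)
  have hsplit : ((n : ℝ) / 2) ^ (-s) = (n : ℝ) ^ (-s) * 2 ^ s := by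
    rw [Real.div_rpow (by positivity) (by norm_num), Real.rpow_neg (by norm_num : (0:ℝ) ≤ 2),
      div_eq_mul_inv, inv_inv]
  have h2s : (2 : ℝ) ^ s ≤ 2 := by
    conv_rhs => rw [← Real.rpow_one 2]
    exact Real.rpow_le_rpow_of_exponent_le (by norm_num) hs1
  have hns : 0 ≤ (n : ℝ) ^ (-s) := Real.rpow_nonneg (by positivity) _
  calc Real.log (10 + |ξ|) ^ (-s) * |ξ| ≤ ((n : ℝ) ^ (-s) * 2 ^ s) * 2 ^ (n + 1) := by
        rw [← hsplit]
        exact mul_le_mul hθ h2.le (abs_nonneg _) (Real.rpow_nonneg hnpos.le _)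
    _ ≤ ((n : ℝ) ^ (-s) * 2) * 2 ^ (n + 1) := by gcongr
    _ = 4 * ((n : ℝ) ^ (-s) * 2 ^ n) := by rw [pow_succ]; ring

/-- The smooth part `2⟨ξ⟩^{1/2} = 2(1+ξ²)^{1/4}` of the weight of BD18 (3.7): differentiable with
`|∂ξ 2(1+ξ²)^{1/4}| ≤ 1`. [cite: BourgainDyatlov2018, §3.1, (3.7)] -/
theorem deriv_japaneseBracket_quarter :
    (Differentiable ℝ fun ξ : ℝ => 2 * (1 + ξ ^ 2) ^ (1 / 4 : ℝ)) ∧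
      ∀ ξ : ℝ, |deriv (fun ξ : ℝ => 2 * (1 + ξ ^ 2) ^ (1 / 4 : ℝ)) ξ| ≤ 1 := by
  have hpos : ∀ ξ : ℝ, 0 < 1 + ξ ^ 2 := fun ξ => by positivity
  have hd : ∀ ξ : ℝ, HasDerivAt (fun ξ : ℝ => 2 * (1 + ξ ^ 2) ^ (1 / 4 : ℝ))
      (2 * ((2 * ξ) * (1 / 4) * (1 + ξ ^ 2) ^ ((1 / 4 : ℝ) - 1))) ξ := by
    intro ξ
    have h1 : HasDerivAt (fun ξ : ℝ => 1 + ξ ^ 2) (2 * ξ) ξ := by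
      simpa using (hasDerivAt_pow 2 ξ).const_add 1
    exact (h1.rpow_const (Or.inl (hpos ξ).ne')).const_mul 2
  refine ⟨fun ξ => (hd ξ).differentiableAt, fun ξ => ?_⟩
  rw [(hd ξ).deriv]
  -- `|ξ| (1+ξ²)^{-3/4} ≤ 1`
  have hq : (1 + ξ ^ 2) ^ ((1 / 4 : ℝ) - 1) = ((1 + ξ ^ 2) ^ (3 / 4 : ℝ))⁻¹ := by
    rw [← Real.rpow_neg (hpos ξ).le]; norm_num
  rw [hq]
  have h34 : |ξ| ≤ (1 + ξ ^ 2) ^ (3 / 4 : ℝ) := by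
    have hb : 1 ≤ 1 + ξ ^ 2 := by nlinarith
    have h1 : |ξ| ≤ (1 + ξ ^ 2) ^ (1 / 2 : ℝ) := by
      rw [← Real.sqrt_eq_rpow]
      refine Real.abs_le_sqrt ?_
      nlinarith
    have h2 : (1 + ξ ^ 2) ^ (1 / 2 : ℝ) ≤ (1 + ξ ^ 2) ^ (3 / 4 : ℝ) :=
      Real.rpow_le_rpow_of_exponent_le hb (by norm_num)
    exact h1.trans h2
  have hposq : 0 < (1 + ξ ^ 2) ^ (3 / 4 : ℝ) := Real.rpow_pos_of_pos (hpos ξ) _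
  have : |2 * (2 * ξ * (1 / 4) * ((1 + ξ ^ 2) ^ (3 / 4 : ℝ))⁻¹)| = |ξ| / (1 + ξ ^ 2) ^ (3 / 4 : ℝ) := by
    rw [show 2 * (2 * ξ * (1 / 4) * ((1 + ξ ^ 2) ^ (3 / 4 : ℝ))⁻¹) = ξ / (1 + ξ ^ 2) ^ (3 / 4 : ℝ)
      by ring, abs_div, abs_of_pos hposq]
  rw [this, div_le_one hposq]
  exact h34

/-- The smooth part `2(1+ξ²)^{1/4}` of the weight exponent is `C¹` (indeed smooth).
[cite: BourgainDyatlov2018, §3.1, (3.7)] -/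
theorem contDiff_japaneseBracket_quarter :
    ContDiff ℝ 1 fun ξ : ℝ => 2 * (1 + ξ ^ 2) ^ (1 / 4 : ℝ) :=
  contDiff_const.mul ((contDiff_const.add (contDiff_id.pow 2)).rpow_const_of_ne
    fun ξ => ne_of_gt (by positivity))

/-- Integrability of the smooth part of `|log ω|/(1+ξ²)` (BD18 (3.6) for the factor
`exp(-2⟨ξ⟩^{1/2})`): `2(1+ξ²)^{1/4}/(1+ξ²)` is integrable on `ℝ`. [cite: BourgainDyatlov2018, §3.1] -/
theorem integrable_japaneseBracket_quarter_div :
    Integrable fun ξ : ℝ => 2 * (1 + ξ ^ 2) ^ (1 / 4 : ℝ) / (1 + ξ ^ 2) := by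
  -- compare with `(1 + ‖ξ‖)^{-3/2}`
  have href : Integrable fun ξ : ℝ => (1 + ‖ξ‖) ^ (-(3 / 2 : ℝ)) :=
    integrable_one_add_norm (by rw [Module.finrank_self]; norm_num)
  have hcont : Continuous fun ξ : ℝ => 2 * (1 + ξ ^ 2) ^ (1 / 4 : ℝ) / (1 + ξ ^ 2) := by
    refine Continuous.div ?_ (continuous_const.add (continuous_id.pow 2)) fun ξ => by positivity
    exact continuous_const.mul ((continuous_const.add (continuous_id.pow 2)).rpow_const
      fun ξ => Or.inr (by norm_num))
  refine Integrable.mono' (href.const_mul 4) hcont.aestronglyMeasurable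
    (Filter.Eventually.of_forall fun ξ => ?_)
  have hpos : 0 < 1 + ξ ^ 2 := by positivity
  have hnn : 0 ≤ 2 * (1 + ξ ^ 2) ^ (1 / 4 : ℝ) / (1 + ξ ^ 2) :=
    div_nonneg (mul_nonneg zero_le_two (Real.rpow_nonneg hpos.le _)) hpos.le
  rw [Real.norm_of_nonneg hnn, Real.norm_eq_abs]
  -- `2 (1+ξ²)^{1/4} / (1+ξ²) = 2 (1+ξ²)^{-3/4} ≤ 4 (1+|ξ|)^{-3/2}`
  have h1 : 2 * (1 + ξ ^ 2) ^ (1 / 4 : ℝ) / (1 + ξ ^ 2) = 2 * (1 + ξ ^ 2) ^ (-(3 / 4) : ℝ) := by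
    rw [show (-(3 / 4) : ℝ) = 1 / 4 - 1 by norm_num, Real.rpow_sub hpos, Real.rpow_one,
      mul_div_assoc]
  rw [h1]
  have h2 : (1 + ξ ^ 2) ^ (-(3 / 4) : ℝ) ≤ ((1 + |ξ|) ^ 2 / 2) ^ (-(3 / 4) : ℝ) := by
    apply Real.rpow_le_rpow_of_nonpos (by positivity) ?_ (by norm_num)
    nlinarith [sq_abs ξ, abs_nonneg ξ, sq_nonneg (1 - |ξ|)]
  have h3 : ((1 + |ξ|) ^ 2 / 2) ^ (-(3 / 4) : ℝ) = 2 ^ (3 / 4 : ℝ) * (1 + |ξ|) ^ (-(3 / 2) : ℝ) := by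
    rw [Real.div_rpow (by positivity) (by norm_num), Real.rpow_neg (by norm_num : (0:ℝ) ≤ 2),
      div_eq_mul_inv, inv_inv, mul_comm]
    congr 1
    rw [show ((1 + |ξ|) ^ 2 : ℝ) = (1 + |ξ|) ^ (2 : ℝ) by norm_cast, ← Real.rpow_mul (by positivity)]
    norm_num
  have h4 : (2 : ℝ) ^ (3 / 4 : ℝ) ≤ 2 := by
    conv_rhs => rw [← Real.rpow_one 2]
    exact Real.rpow_le_rpow_of_exponent_le (by norm_num) (by norm_num)
  calc 2 * (1 + ξ ^ 2) ^ (-(3 / 4) : ℝ) ≤ 2 * (2 ^ (3 / 4 : ℝ) * (1 + |ξ|) ^ (-(3 / 2) : ℝ)) := by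
        rw [← h3]; exact mul_le_mul_of_nonneg_left h2 (by norm_num)
    _ ≤ 2 * (2 * (1 + |ξ|) ^ (-(3 / 2) : ℝ)) := by gcongr
    _ = 4 * (1 + |ξ|) ^ (-(3 / 2) : ℝ) := by ring


/-- **Derivative bookkeeping for one generation of cells** (BD18 §3.1: "each `ξ` lies in at
most 500 intervals `J̃`", within one generation): for cutoffs `χ_J` of cells of a common size
`ρ` with centres `(j + 1/2)ρ`, `j ∈ S`, one has `Σ_{j ∈ S} |∂χ_J(ξ)| ≤ 3K` at every point.
[cite: BourgainDyatlov2018, §3.1, proof of Lemma 3.1] -/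
theorem sum_abs_deriv_cutoff_le {χ : ℝ → ℝ} (hχd : Differentiable ℝ χ) (hχ0 : ∀ x, 0 ≤ χ x)
    (hχ1 : ∀ x, χ x ≤ 1) (hχone : ∀ x, |x| ≤ 1 / 2 → χ x = 1) (hχzero : ∀ x, 1 ≤ |x| → χ x = 0)
    {K : ℝ} (hK0 : 0 ≤ K) (hK : ∀ x, |deriv χ x| ≤ K) {ρ : ℝ} (hρ : 0 < ρ) (S : Finset ℤ) (ξ : ℝ) :
    ∑ j ∈ S, |deriv (fun ξ => ρ * χ ((ξ - (j + 1 / 2) * ρ) / ρ)) ξ| ≤ 3 * K := by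
  classical
  -- split `S` according to whether `ξ` is within `ρ` of the centre
  rw [← Finset.sum_filter_add_sum_filter_not S (fun j : ℤ => |ξ - (j + 1 / 2) * ρ| ≤ ρ)]
  have hzero : ∑ j ∈ S.filter (fun j : ℤ => ¬ |ξ - (j + 1 / 2) * ρ| ≤ ρ),
      |deriv (fun ξ => ρ * χ ((ξ - (j + 1 / 2) * ρ) / ρ)) ξ| = 0 := by
    refine Finset.sum_eq_zero fun j hj => ?_
    have hfar : ρ < |ξ - (j + 1 / 2) * ρ| := lt_of_not_ge (Finset.mem_filter.1 hj).2
    -- the cutoff vanishes on a neighbourhood of `ξ`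
    have hev : (fun η => ρ * χ ((η - (j + 1 / 2) * ρ) / ρ)) =ᶠ[nhds ξ] fun _ => (0 : ℝ) := by
      have hopen : IsOpen {η : ℝ | ρ < |η - (j + 1 / 2) * ρ|} :=
        isOpen_lt continuous_const ((continuous_id.sub continuous_const).abs)
      filter_upwards [hopen.mem_nhds hfar] with η hη
      exact (scaled_cutoff hχd hχ0 hχ1 hχone hχzero hK hρ ((j + 1 / 2) * ρ)).2.2.2.2.1 η
        (le_of_lt hη)
    rw [hev.deriv_eq, deriv_const, abs_zero]
  rw [hzero, add_zero]
  calc ∑ j ∈ S.filter (fun j : ℤ => |ξ - (j + 1 / 2) * ρ| ≤ ρ),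
        |deriv (fun ξ => ρ * χ ((ξ - (j + 1 / 2) * ρ) / ρ)) ξ|
      ≤ ∑ _j ∈ S.filter (fun j : ℤ => |ξ - (j + 1 / 2) * ρ| ≤ ρ), K :=
        Finset.sum_le_sum fun j _ =>
          (scaled_cutoff hχd hχ0 hχ1 hχone hχzero hK hρ ((j + 1 / 2) * ρ)).2.2.2.2.2 ξ
    _ = (S.filter (fun j : ℤ => |ξ - (j + 1 / 2) * ρ| ≤ ρ)).card * K := by
        rw [Finset.sum_const, nsmul_eq_mul]
    _ ≤ 3 * K := by
        have h3 := card_filter_near_le_three S hρ ξ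
        have : ((S.filter (fun j : ℤ => |ξ - (j + 1 / 2) * ρ| ≤ ρ)).card : ℝ) ≤ 3 := by
          exact_mod_cast h3
        exact mul_le_mul_of_nonneg_right this hK0

/-- **Integral bookkeeping for one generation of cells** (BD18 §3.1, the bound
`∫ |log ω|/(1+ξ²) ≤ … Σ_n N_n 2^{-2n} ρ_n²`): for cutoffs `χ_J` of `#S` cells of size `ρ` all of
whose doubled cells lie in `{|ξ| ≥ R}`, `Σ_{j∈S} ∫ χ_J/(1+ξ²) ≤ #S · 2ρ²/(1+R²)`.
[cite: BourgainDyatlov2018, §3.1, proof of Lemma 3.1] -/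
theorem sum_integral_cutoff_div_le {χ : ℝ → ℝ} (hχd : Differentiable ℝ χ) (hχ0 : ∀ x, 0 ≤ χ x)
    (hχ1 : ∀ x, χ x ≤ 1) (hχone : ∀ x, |x| ≤ 1 / 2 → χ x = 1) (hχzero : ∀ x, 1 ≤ |x| → χ x = 0)
    {K : ℝ} (hK : ∀ x, |deriv χ x| ≤ K) {ρ : ℝ} (hρ : 0 < ρ) (S : Finset ℤ) {R : ℝ} (hR : 0 ≤ R)
    (hfar : ∀ j ∈ S, ∀ ξ, |ξ - (j + 1 / 2) * ρ| < ρ → R ≤ |ξ|) :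
    (∀ j ∈ S, Integrable fun ξ => ρ * χ ((ξ - (j + 1 / 2) * ρ) / ρ) / (1 + ξ ^ 2)) ∧
    ∑ j ∈ S, ∫ ξ, ρ * χ ((ξ - (j + 1 / 2) * ρ) / ρ) / (1 + ξ ^ 2) ≤
      S.card * (2 * ρ * (ρ / (1 + R ^ 2))) := by
  have hcell : ∀ j ∈ S, Integrable (fun ξ => ρ * χ ((ξ - (j + 1 / 2) * ρ) / ρ) / (1 + ξ ^ 2)) ∧
      ∫ ξ, ρ * χ ((ξ - (j + 1 / 2) * ρ) / ρ) / (1 + ξ ^ 2) ≤ 2 * ρ * (ρ / (1 + R ^ 2)) := by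
    intro j hj
    have hsc := scaled_cutoff hχd hχ0 hχ1 hχone hχzero hK hρ ((j + 1 / 2) * ρ)
    exact integral_bump_div_le hρ hR hsc.1.continuous hsc.2.2.1 hsc.2.2.2.2.1 (hfar j hj)
  refine ⟨fun j hj => (hcell j hj).1, ?_⟩
  calc ∑ j ∈ S, ∫ ξ, ρ * χ ((ξ - (j + 1 / 2) * ρ) / ρ) / (1 + ξ ^ 2)
      ≤ ∑ _j ∈ S, 2 * ρ * (ρ / (1 + R ^ 2)) := Finset.sum_le_sum fun j hj => (hcell j hj).2
    _ = S.card * (2 * ρ * (ρ / (1 + R ^ 2))) := by rw [Finset.sum_const, nsmul_eq_mul]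

/-- **One dyadic generation of the adapted weight** (BD18 §3.1: the cells `J ∈ 𝒥_n` of size
`ρ_n = n^{-(1+δ)/2} 2^n` covering `Y ∩ A_n`, `A_n = ±[2^n, 2^{n+1}]`, with
`N_n ≤ 24 C_R² (2^n/ρ_n)^δ`): for a `δ`-regular `Y` on scales `2` to `α₁` and a window
`[a, b]` of length `2^n ≤ α₁` inside `{2^n ≤ |ξ| ≤ 2^{n+1}}`, there is a finite set `S` of
grid indices with `#S ≤ 6 C_R² n^{δ(1+δ)/2}` whose cells of size `ρ_n` cover `Y ∩ [a, b]`
(each point of `Y ∩ [a,b]` is within `ρ_n/2` of a centre `(j + 1/2)ρ_n`), and such that, when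
`n ≥ 16`, every point within `ρ_n` of one of these centres has `2^{n-1} ≤ |ξ| < 2^{n+2}`.
[cite: BourgainDyatlov2018, §3.1, proof of Lemma 3.1] -/
theorem exists_dyadic_generation {Y : Set ℝ} {δ C_R α₁ : ℝ} (hY : IsRegularSet Y δ C_R 2 α₁)
    (hC : 1 ≤ C_R) (hδ0 : 0 ≤ δ) (hδ1 : δ ≤ 1) {n : ℕ} (hn : 1 ≤ n) {a b : ℝ}
    (hab : b - a = 2 ^ n) (hα : (2 : ℝ) ^ n ≤ α₁)
    (hwin : ∀ y ∈ Icc a b, (2 : ℝ) ^ n ≤ |y| ∧ |y| ≤ 2 ^ (n + 1)) {ρ : ℝ}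
    (hρ : ρ = (n : ℝ) ^ (-(1 + δ) / 2) * 2 ^ n) :
    ∃ S : Finset ℤ, (S.card : ℝ) ≤ 6 * C_R ^ 2 * (n : ℝ) ^ ((1 + δ) / 2 * δ) ∧
      (∀ ξ ∈ Y ∩ Icc a b, ∃ j ∈ S, |ξ - (j + 1 / 2) * ρ| ≤ ρ / 2) ∧
      (16 ≤ n → ∀ j ∈ S, ∀ ξ, |ξ - (j + 1 / 2) * ρ| ≤ ρ →
        (2 : ℝ) ^ n / 2 ≤ |ξ| ∧ |ξ| < 2 ^ n * 4) := by
  have hC0 : 0 < C_R := by linarith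
  obtain ⟨hρ2, hρn⟩ := dyadicScale_bounds hδ0 hδ1 hn
  rw [← hρ] at hρ2 hρn
  have hρ0 : 0 < ρ := by linarith
  have hnpos : (0 : ℝ) < n := by exact_mod_cast hn
  obtain ⟨S, hcov, hmeet, hcard⟩ := hY.small_cover hC0 hρ0 hρ2 (by rw [hab]; exact hρn)
    (by rw [hab]; exact hα)
  have hratio : (b - a) / ρ = (n : ℝ) ^ ((1 + δ) / 2) := by
    rw [hab, hρ, show (-(1 + δ) / 2 : ℝ) = -((1 + δ) / 2) by ring, Real.rpow_neg hnpos.le]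
    field_simp
  refine ⟨S, ?_, ?_, ?_⟩
  · rw [hratio, ← Real.rpow_mul hnpos.le] at hcard
    exact hcard
  · intro ξ hξ
    obtain ⟨j, hj, hξj⟩ : ∃ j ∈ S, ξ ∈ Icc ((j : ℝ) * ρ) ((j + 1) * ρ) := by
      simpa only [Set.mem_iUnion, exists_prop] using hcov hξ
    refine ⟨j, hj, ?_⟩
    rw [abs_le]
    constructor <;> nlinarith [hξj.1, hξj.2]
  · intro h16 j hj ξ hξ
    obtain ⟨y, ⟨⟨-, hyab⟩, hycell⟩⟩ := hmeet j hj
    have hy := hwin y hyab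
    -- `|y - centre| ≤ ρ/2`, so `|ξ - y| ≤ 3ρ/2 ≤ (3/8) 2^n`
    have hyc : |y - (j + 1 / 2) * ρ| ≤ ρ / 2 := by
      rw [abs_le]; constructor <;> nlinarith [hycell.1, hycell.2]
    have hξy : |ξ - y| ≤ 3 / 2 * ρ := by
      calc |ξ - y| = |(ξ - (j + 1 / 2) * ρ) - (y - (j + 1 / 2) * ρ)| := by ring_nf
        _ ≤ |ξ - (j + 1 / 2) * ρ| + |y - (j + 1 / 2) * ρ| := abs_sub _ _
        _ ≤ 3 / 2 * ρ := by linarith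
    -- `ρ ≤ 2^n / 4` for `n ≥ 16`
    have hρsmall : ρ ≤ 2 ^ n / 4 := by
      have hn16 : (16 : ℝ) ≤ n := by exact_mod_cast h16
      have h1 : (n : ℝ) ^ (-(1 + δ) / 2) ≤ (n : ℝ) ^ (-(1 / 2) : ℝ) :=
        Real.rpow_le_rpow_of_exponent_le (by linarith) (by linarith)
      have h2 : (n : ℝ) ^ (-(1 / 2) : ℝ) ≤ (16 : ℝ) ^ (-(1 / 2) : ℝ) :=
        Real.rpow_le_rpow_of_nonpos (by norm_num) hn16 (by norm_num)
      have h3 : (16 : ℝ) ^ (-(1 / 2) : ℝ) = 1 / 4 := by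
        rw [show (16 : ℝ) = 4 ^ (2 : ℝ) by norm_num, ← Real.rpow_mul (by norm_num)]
        norm_num
      rw [hρ]
      have : (n : ℝ) ^ (-(1 + δ) / 2) ≤ 1 / 4 := by linarith
      calc (n : ℝ) ^ (-(1 + δ) / 2) * 2 ^ n ≤ 1 / 4 * 2 ^ n :=
            mul_le_mul_of_nonneg_right this (by positivity)
        _ = 2 ^ n / 4 := by ring
    have h1 := abs_sub_abs_le_abs_sub ξ y   -- |ξ| - |y| ≤ |ξ - y|
    have h2 := abs_sub_abs_le_abs_sub y ξ
    rw [abs_sub_comm] at h2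
    have hpow : (2 : ℝ) ^ (n + 1) = 2 ^ n * 2 := pow_succ 2 n
    constructor
    · nlinarith [hy.1]
    · nlinarith [hy.2]


/-- Away from its doubled cell a scaled cutoff is locally zero, so its derivative vanishes.
[cite: BourgainDyatlov2018, §3.1] -/
theorem deriv_cutoff_eq_zero_of_far {χ : ℝ → ℝ} (hχd : Differentiable ℝ χ) (hχ0 : ∀ x, 0 ≤ χ x)
    (hχ1 : ∀ x, χ x ≤ 1) (hχone : ∀ x, |x| ≤ 1 / 2 → χ x = 1) (hχzero : ∀ x, 1 ≤ |x| → χ x = 0)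
    {K : ℝ} (hK : ∀ x, |deriv χ x| ≤ K) {ρ : ℝ} (hρ : 0 < ρ) (m : ℝ) {ξ : ℝ} (hfar : ρ < |ξ - m|) :
    deriv (fun ξ => ρ * χ ((ξ - m) / ρ)) ξ = 0 := by
  have hev : (fun η => ρ * χ ((η - m) / ρ)) =ᶠ[nhds ξ] fun _ => (0 : ℝ) := by
    have hopen : IsOpen {η : ℝ | ρ < |η - m|} :=
      isOpen_lt continuous_const ((continuous_id.sub continuous_const).abs)
    filter_upwards [hopen.mem_nhds hfar] with η hη
    exact (scaled_cutoff hχd hχ0 hχ1 hχone hχzero hK hρ m).2.2.2.2.1 η (le_of_lt hη)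
  rw [hev.deriv_eq, deriv_const]

/-- **Integral of one generation** (BD18 §3.1, the two regimes of the bound on
`∫ |log ω|/(1+ξ²)`): with `ρ_n = n^{-(1+δ)/2} 2^n`, `#S ≤ 6 C_R² n^{δ(1+δ)/2}` cells, and — for
`n ≥ 16` — doubled cells inside `{|ξ| ≥ 2^{n-1}}`, the generation contributes at most
`180 · 2^30 C_R²` (any `n ≤ 15`) and at most `48 C_R² n^{-(1+δ)(2-δ)/2}` (`n ≥ 16`).
[cite: BourgainDyatlov2018, §3.1, proof of Lemma 3.1] -/
theorem generation_integral_le {χ : ℝ → ℝ} (hχd : Differentiable ℝ χ) (hχ0 : ∀ x, 0 ≤ χ x)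
    (hχ1 : ∀ x, χ x ≤ 1) (hχone : ∀ x, |x| ≤ 1 / 2 → χ x = 1) (hχzero : ∀ x, 1 ≤ |x| → χ x = 0)
    {K : ℝ} (hK : ∀ x, |deriv χ x| ≤ K) {δ C_R : ℝ} (hδ0 : 0 ≤ δ) (hδ1 : δ ≤ 1) (hC : 1 ≤ C_R)
    {n : ℕ} (hn : 1 ≤ n) {ρ : ℝ} (hρ : ρ = (n : ℝ) ^ (-(1 + δ) / 2) * 2 ^ n) (S : Finset ℤ)
    (hcard : (S.card : ℝ) ≤ 6 * C_R ^ 2 * (n : ℝ) ^ ((1 + δ) / 2 * δ))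
    (hwin : 16 ≤ n → ∀ j ∈ S, ∀ ξ, |ξ - (j + 1 / 2) * ρ| ≤ ρ → (2 : ℝ) ^ n / 2 ≤ |ξ|) :
    (∀ j ∈ S, Integrable fun ξ => ρ * χ ((ξ - (j + 1 / 2) * ρ) / ρ) / (1 + ξ ^ 2)) ∧
    (n < 16 → ∑ j ∈ S, ∫ ξ, ρ * χ ((ξ - (j + 1 / 2) * ρ) / ρ) / (1 + ξ ^ 2) ≤
      180 * 2 ^ 30 * C_R ^ 2) ∧
    (16 ≤ n → ∑ j ∈ S, ∫ ξ, ρ * χ ((ξ - (j + 1 / 2) * ρ) / ρ) / (1 + ξ ^ 2) ≤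
      48 * C_R ^ 2 * (n : ℝ) ^ (-((1 + δ) / 2 * (2 - δ)))) := by
  obtain ⟨hρ2, hρn⟩ := dyadicScale_bounds hδ0 hδ1 hn
  rw [← hρ] at hρ2 hρn
  have hρ0 : 0 < ρ := by linarith
  have hnpos : (0 : ℝ) < n := by exact_mod_cast hn
  have hn1 : (1 : ℝ) ≤ n := by exact_mod_cast hn
  have hcard0 : (0 : ℝ) ≤ S.card := Nat.cast_nonneg _
  -- the crude bound, `R = 0`
  obtain ⟨hint, hcrude⟩ := sum_integral_cutoff_div_le hχd hχ0 hχ1 hχone hχzero hK hρ0 S le_rfl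
    (fun _ _ ξ _ => abs_nonneg ξ)
  refine ⟨hint, fun h15 => ?_, fun h16 => ?_⟩
  · -- `n ≤ 15`: `#S ≤ 6 C_R² n ≤ 90 C_R²`, `2ρ² ≤ 2 · 4^15`
    have hnδ : (n : ℝ) ^ ((1 + δ) / 2 * δ) ≤ 15 := by
      have h1 : (n : ℝ) ^ ((1 + δ) / 2 * δ) ≤ (n : ℝ) ^ (1 : ℝ) :=
        Real.rpow_le_rpow_of_exponent_le hn1 (by nlinarith)
      rw [Real.rpow_one] at h1
      have : (n : ℝ) ≤ 15 := by exact_mod_cast Nat.lt_succ_iff.1 h15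
      linarith
    have hρ15 : ρ ≤ 2 ^ 15 := hρn.trans (pow_le_pow_right₀ (by norm_num) (by omega))
    have hS : (S.card : ℝ) ≤ 90 * C_R ^ 2 := by nlinarith [hcard, sq_nonneg C_R]
    calc ∑ j ∈ S, ∫ ξ, ρ * χ ((ξ - (j + 1 / 2) * ρ) / ρ) / (1 + ξ ^ 2)
        ≤ S.card * (2 * ρ * (ρ / (1 + 0 ^ 2))) := hcrude
      _ = S.card * (2 * ρ ^ 2) := by ring
      _ ≤ (90 * C_R ^ 2) * (2 * (2 ^ 15) ^ 2) := by gcongr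
      _ = 180 * 2 ^ 30 * C_R ^ 2 := by norm_num; ring
  · -- `n ≥ 16`: `R = 2^n / 2`
    obtain ⟨-, hfine⟩ := sum_integral_cutoff_div_le hχd hχ0 hχ1 hχone hχzero hK hρ0 S
      (R := (2 : ℝ) ^ n / 2) (by positivity)
      (fun j hj ξ hξ => hwin h16 j hj ξ hξ.le)
    have hkey : 2 * ρ * (ρ / (1 + ((2 : ℝ) ^ n / 2) ^ 2)) ≤ 8 * (n : ℝ) ^ (-(1 + δ)) := by
      -- `ρ / 2^n = n^{-(1+δ)/2}`
      have hq : ρ ^ 2 = (n : ℝ) ^ (-(1 + δ)) * 4 ^ n := by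
        rw [hρ, mul_pow, ← Real.rpow_natCast ((n : ℝ) ^ (-(1 + δ) / 2)) 2,
          ← Real.rpow_mul hnpos.le]
        congr 1
        · congr 1; push_cast; ring
        · rw [← pow_mul, show (4 : ℝ) = 2 ^ 2 by norm_num, ← pow_mul, mul_comm]
      have h4n : (0 : ℝ) < 4 ^ n := by positivity
      have hden : (4 : ℝ) ^ n / 4 ≤ 1 + ((2 : ℝ) ^ n / 2) ^ 2 := by
        rw [div_pow, ← pow_mul, show (2 : ℝ) ^ (n * 2) = 4 ^ n by
          rw [mul_comm, pow_mul]; norm_num]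
        linarith
      have hnn : 0 ≤ (n : ℝ) ^ (-(1 + δ)) := Real.rpow_nonneg hnpos.le _
      calc 2 * ρ * (ρ / (1 + ((2 : ℝ) ^ n / 2) ^ 2)) = 2 * ρ ^ 2 / (1 + ((2 : ℝ) ^ n / 2) ^ 2) := by
            ring
        _ ≤ 2 * ρ ^ 2 / ((4 : ℝ) ^ n / 4) :=
            div_le_div_of_nonneg_left (by positivity) (by positivity) hden
        _ = 8 * (n : ℝ) ^ (-(1 + δ)) := by rw [hq]; field_simp; norm_num
    have hexp : (n : ℝ) ^ ((1 + δ) / 2 * δ) * (n : ℝ) ^ (-(1 + δ)) =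
        (n : ℝ) ^ (-((1 + δ) / 2 * (2 - δ))) := by
      rw [← Real.rpow_add hnpos]; congr 1; ring
    calc ∑ j ∈ S, ∫ ξ, ρ * χ ((ξ - (j + 1 / 2) * ρ) / ρ) / (1 + ξ ^ 2)
        ≤ S.card * (2 * ρ * (ρ / (1 + ((2 : ℝ) ^ n / 2) ^ 2))) := hfine
      _ ≤ (6 * C_R ^ 2 * (n : ℝ) ^ ((1 + δ) / 2 * δ)) * (8 * (n : ℝ) ^ (-(1 + δ))) :=
          mul_le_mul hcard hkey (by positivity) (by positivity)
      _ = 48 * C_R ^ 2 * (n : ℝ) ^ (-((1 + δ) / 2 * (2 - δ))) := by rw [← hexp]; ring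


/-- **The weight adapted to a regular set** (BD18 §3.1, proof of Lemma 3.1, (3.6)–(3.9), in
logarithmic form `Ω = -log ω`): for `0 < δ < 1` and `C_R ≥ 1` there is `C₀ = C₀(δ, C_R)` such
that for every `Y ⊂ [-α₁, α₁]` that is `δ`-regular with constant `C_R` on scales `2` to `α₁`
there is a weight exponent `Ω : ℝ → ℝ` with
* `Ω(ξ) ≥ 2⟨ξ⟩^{1/2}` (so `ω = e^{-Ω} ∈ (0, 1]` and `ω ≤ exp(-⟨ξ⟩^{1/2})`, BD18 (3.8));
* `Ω ∈ C¹`, `|Ω'| ≤ C₀`, so `Ω` is `C₀`-Lipschitz (BD18 (2.7): `sup |∂ log ω| ≤ C₀`);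
* `∫ Ω(ξ)/(1+ξ²) dξ ≤ C₀` (BD18 (2.6));
* `Ω(ξ) ≥ θ(ξ)|ξ|` on `Y`, `θ(ξ) = log(10+|ξ|)^{-(1+δ)/2}` (BD18 (3.9)).
The construction is the printed one, `Ω = 2⟨ξ⟩^{1/2} + 10 Σ_n Σ_{J ∈ 𝒥_n} χ_J` over the dyadic
generations `1 ≤ n`, `2^n ≤ α₁`, with cells of size `ρ_n = n^{-(1+δ)/2} 2^n` from the small
cover property; the overlap count uses that for `n ≥ 16` a doubled cell of generation `n` only
sees points with `2^{n-1} ≤ |ξ| < 2^{n+2}`. [cite: BourgainDyatlov2018, Lemma 3.1, (3.6)–(3.9)] -/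
theorem exists_adapted_weight {δ C_R : ℝ} (hδ0 : 0 < δ) (hδ1 : δ < 1) (hC : 1 ≤ C_R) :
    ∃ C₀ : ℝ, 0 < C₀ ∧ ∀ (α₁ : ℝ) (Y : Set ℝ), Y ⊆ Icc (-α₁) α₁ → IsRegularSet Y δ C_R 2 α₁ →
      ∃ Ω : ℝ → ℝ, (∀ ξ, 2 * (1 + ξ ^ 2) ^ (1 / 4 : ℝ) ≤ Ω ξ) ∧
        (ContDiff ℝ 1 Ω ∧ (∀ ξ, |deriv Ω ξ| ≤ C₀) ∧ ∀ ξ η, |Ω ξ - Ω η| ≤ C₀ * |ξ - η|) ∧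
        Integrable (fun ξ => Ω ξ / (1 + ξ ^ 2)) ∧ (∫ ξ, Ω ξ / (1 + ξ ^ 2) ≤ C₀) ∧
        ∀ ξ ∈ Y, Real.log (10 + |ξ|) ^ (-(1 + δ) / 2) * |ξ| ≤ Ω ξ := by
  classical
  obtain ⟨χ, hχcd, hχd, hχ0, hχ1, hχone, hχzero, K, hK0, hK⟩ := exists_cutoff
  -- the `p`-series constant, `p = (1+δ)(2-δ)/2 > 1`
  set p : ℝ := (1 + δ) / 2 * (2 - δ) with hp
  have hp1 : 1 < p := by rw [hp]; nlinarith
  have hsum : Summable fun n : ℕ => (n : ℝ) ^ (-p) := Real.summable_nat_rpow.2 (by linarith)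
  set Z : ℝ := ∑' n : ℕ, (n : ℝ) ^ (-p) with hZ
  have hZ0 : 0 ≤ Z := tsum_nonneg fun n => Real.rpow_nonneg (Nat.cast_nonneg n) _
  set A₀ : ℝ := ∫ ξ : ℝ, 2 * (1 + ξ ^ 2) ^ (1 / 4 : ℝ) / (1 + ξ ^ 2) with hA₀
  have hA₀0 : 0 ≤ A₀ := integral_nonneg fun ξ => by show (0:ℝ) ≤ _; positivity
  set C₀ : ℝ := (1 + 1080 * K) + (A₀ + 10 * (2700 * 2 ^ 31 * C_R ^ 2 + 96 * C_R ^ 2 * Z))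
    with hC₀
  have hI0 : 0 ≤ A₀ + 10 * (2700 * 2 ^ 31 * C_R ^ 2 + 96 * C_R ^ 2 * Z) := by positivity
  have hCL : 1 + 1080 * K ≤ C₀ := by rw [hC₀]; linarith
  have hCI : A₀ + 10 * (2700 * 2 ^ 31 * C_R ^ 2 + 96 * C_R ^ 2 * Z) ≤ C₀ := by
    rw [hC₀]; nlinarith
  refine ⟨C₀, by positivity, ?_⟩
  intro α₁ Y hYsub hY
  -- the dyadic scales
  obtain ⟨ρ, hρ⟩ : ∃ ρ : ℕ → ℝ, ∀ n, ρ n = (n : ℝ) ^ (-(1 + δ) / 2) * 2 ^ n := ⟨_, fun _ => rfl⟩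
  have hρpos : ∀ n, 1 ≤ n → 0 < ρ n := fun n hn => by
    have := (dyadicScale_bounds hδ0.le hδ1.le hn).1; rw [← hρ] at this; linarith
  -- the generations `1 ≤ n`, `2^n ≤ α₁`, and their cells (two windows `±[2^n, 2^{n+1}]`)
  set 𝒩 : Finset ℕ := (Finset.range (⌊α₁⌋₊ + 1)).filter fun n => 1 ≤ n ∧ (2 : ℝ) ^ n ≤ α₁
    with h𝒩
  have h𝒩mem : ∀ n ∈ 𝒩, 1 ≤ n ∧ (2 : ℝ) ^ n ≤ α₁ := fun n hn => (Finset.mem_filter.1 hn).2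
  have hgen : ∀ (n : ℕ) (σ : ℝ), ∃ S : Finset ℤ, (1 ≤ n ∧ (2 : ℝ) ^ n ≤ α₁ ∧ (σ = 1 ∨ σ = -1)) →
      ((S.card : ℝ) ≤ 6 * C_R ^ 2 * (n : ℝ) ^ ((1 + δ) / 2 * δ) ∧
      (∀ ξ ∈ Y, (2 : ℝ) ^ n ≤ σ * ξ → σ * ξ ≤ 2 ^ (n + 1) →
        ∃ j ∈ S, |ξ - (j + 1 / 2) * ρ n| ≤ ρ n / 2) ∧
      (16 ≤ n → ∀ j ∈ S, ∀ ξ, |ξ - (j + 1 / 2) * ρ n| ≤ ρ n →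
        (2 : ℝ) ^ n / 2 ≤ |ξ| ∧ |ξ| < 2 ^ n * 4)) := by
    intro n σ
    by_cases h : 1 ≤ n ∧ (2 : ℝ) ^ n ≤ α₁ ∧ (σ = 1 ∨ σ = -1)
    · obtain ⟨hn, hα, hσ⟩ := h
      have h2n : (0 : ℝ) < 2 ^ n := by positivity
      rcases hσ with rfl | rfl
      · obtain ⟨S, hS1, hS2, hS3⟩ := exists_dyadic_generation hY hC hδ0.le hδ1.le hn
          (a := (2 : ℝ) ^ n) (b := 2 ^ (n + 1)) (by rw [pow_succ]; ring) hα
          (fun y hy => by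
            rw [abs_of_pos (h2n.trans_le hy.1)]; exact hy) (hρ n)
        refine ⟨S, fun _ => ⟨hS1, fun ξ hξY h1 h2 => hS2 ξ ⟨hξY, ?_⟩, hS3⟩⟩
        rw [one_mul] at h1 h2; exact ⟨h1, h2⟩
      · obtain ⟨S, hS1, hS2, hS3⟩ := exists_dyadic_generation hY hC hδ0.le hδ1.le hn
          (a := -(2 : ℝ) ^ (n + 1)) (b := -2 ^ n) (by rw [pow_succ]; ring) hα
          (fun y hy => by
            rw [abs_of_neg (by linarith [hy.2])]; constructor <;> linarith [hy.1, hy.2]) (hρ n)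
        refine ⟨S, fun _ => ⟨hS1, fun ξ hξY h1 h2 => hS2 ξ ⟨hξY, ?_⟩, hS3⟩⟩
        constructor <;> linarith
    · exact ⟨∅, fun h' => absurd h' h⟩
  choose S hS using hgen
  -- the cutoffs `χ_{n,j}` and the weight exponent `Ω`
  obtain ⟨B, hB⟩ : ∃ B : ℕ → ℤ → ℝ → ℝ,
      ∀ n j ξ, B n j ξ = ρ n * χ ((ξ - (j + 1 / 2) * ρ n) / ρ n) := ⟨_, fun _ _ _ => rfl⟩
  have hBfun : ∀ n j, B n j = fun ξ => ρ n * χ ((ξ - (j + 1 / 2) * ρ n) / ρ n) :=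
    fun n j => funext (hB n j)
  obtain ⟨Ω, hΩ⟩ : ∃ Ω : ℝ → ℝ, ∀ ξ, Ω ξ = 2 * (1 + ξ ^ 2) ^ (1 / 4 : ℝ) +
      10 * ∑ n ∈ 𝒩, (∑ j ∈ S n 1, B n j ξ + ∑ j ∈ S n (-1), B n j ξ) := ⟨_, fun _ => rfl⟩
  -- basic facts on the cutoffs
  have hBfacts : ∀ n ∈ 𝒩, ∀ j : ℤ, Differentiable ℝ (B n j) ∧ (∀ ξ, 0 ≤ B n j ξ) ∧
      (∀ ξ, |ξ - (j + 1 / 2) * ρ n| ≤ ρ n / 2 → B n j ξ = ρ n) ∧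
      (∀ ξ, |deriv (B n j) ξ| ≤ K) := by
    intro n hn j
    have hsc := scaled_cutoff hχd hχ0 hχ1 hχone hχzero hK (hρpos n (h𝒩mem n hn).1)
      ((j + 1 / 2) * ρ n)
    rw [hBfun]
    exact ⟨hsc.1, hsc.2.1, hsc.2.2.2.1, hsc.2.2.2.2.2⟩
  have hsum_nonneg : ∀ ξ, 0 ≤ ∑ n ∈ 𝒩, (∑ j ∈ S n 1, B n j ξ + ∑ j ∈ S n (-1), B n j ξ) :=
    fun ξ => Finset.sum_nonneg fun n hn => add_nonneg
      (Finset.sum_nonneg fun j _ => (hBfacts n hn j).2.1 ξ)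
      (Finset.sum_nonneg fun j _ => (hBfacts n hn j).2.1 ξ)
  have hlower : ∀ ξ, 2 * (1 + ξ ^ 2) ^ (1 / 4 : ℝ) ≤ Ω ξ := fun ξ => by
    rw [hΩ]; linarith [hsum_nonneg ξ]
  -- integrability of the pieces and the generation bounds
  have hJint := integrable_japaneseBracket_quarter_div
  have hgenint : ∀ n ∈ 𝒩, ∀ σ : ℝ, (σ = 1 ∨ σ = -1) →
      (∀ j ∈ S n σ, Integrable fun ξ => B n j ξ / (1 + ξ ^ 2)) ∧
      (n < 16 → ∑ j ∈ S n σ, ∫ ξ, B n j ξ / (1 + ξ ^ 2) ≤ 180 * 2 ^ 30 * C_R ^ 2) ∧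
      (16 ≤ n → ∑ j ∈ S n σ, ∫ ξ, B n j ξ / (1 + ξ ^ 2) ≤
        48 * C_R ^ 2 * (n : ℝ) ^ (-((1 + δ) / 2 * (2 - δ)))) := by
    intro n hn σ hσ
    have hmem := h𝒩mem n hn
    have hSn := hS n σ ⟨hmem.1, hmem.2, hσ⟩
    have h := generation_integral_le hχd hχ0 hχ1 hχone hχzero hK hδ0.le hδ1.le hC hmem.1
      (hρ n) (S n σ) hSn.1 (fun h16 j hj ξ hξ => (hSn.2.2 h16 j hj ξ hξ).1)
    simp only [← hB] at h
    exact h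
  have hΩdiv : ∀ ξ, Ω ξ / (1 + ξ ^ 2) = 2 * (1 + ξ ^ 2) ^ (1 / 4 : ℝ) / (1 + ξ ^ 2) +
      10 * ∑ n ∈ 𝒩, (∑ j ∈ S n 1, B n j ξ / (1 + ξ ^ 2) +
        ∑ j ∈ S n (-1), B n j ξ / (1 + ξ ^ 2)) := by
    intro ξ
    simp only [hΩ, add_div, mul_div_assoc, Finset.sum_div]
  have hrest : Integrable fun ξ => ∑ n ∈ 𝒩, (∑ j ∈ S n 1, B n j ξ / (1 + ξ ^ 2) +
      ∑ j ∈ S n (-1), B n j ξ / (1 + ξ ^ 2)) :=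
    integrable_finsetSum _ fun n hn =>
      (integrable_finsetSum _ fun j hj => (hgenint n hn 1 (Or.inl rfl)).1 j hj).add
        (integrable_finsetSum _ fun j hj => (hgenint n hn (-1) (Or.inr rfl)).1 j hj)
  have hΩint : Integrable fun ξ => Ω ξ / (1 + ξ ^ 2) := by
    rw [show (fun ξ => Ω ξ / (1 + ξ ^ 2)) = fun ξ => 2 * (1 + ξ ^ 2) ^ (1 / 4 : ℝ) / (1 + ξ ^ 2) +
      10 * ∑ n ∈ 𝒩, (∑ j ∈ S n 1, B n j ξ / (1 + ξ ^ 2) +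
        ∑ j ∈ S n (-1), B n j ξ / (1 + ξ ^ 2)) from funext hΩdiv]
    exact hJint.add (hrest.const_mul 10)
  refine ⟨Ω, hlower, ?_, ?_, ?_, ?_⟩
  · ----------------------------------------------------------------
    -- Lipschitz bound via the derivative
    ----------------------------------------------------------------
    obtain ⟨hJd, hJ'⟩ := deriv_japaneseBracket_quarter
    -- derivative of `Ω`
    have hderiv : ∀ ξ, HasDerivAt Ω (deriv (fun ξ : ℝ => 2 * (1 + ξ ^ 2) ^ (1 / 4 : ℝ)) ξ +
        10 * ∑ n ∈ 𝒩, (∑ j ∈ S n 1, deriv (B n j) ξ + ∑ j ∈ S n (-1), deriv (B n j) ξ)) ξ := by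
      intro ξ
      have hΩfun : Ω = fun ξ => 2 * (1 + ξ ^ 2) ^ (1 / 4 : ℝ) +
          10 * ∑ n ∈ 𝒩, (∑ j ∈ S n 1, B n j ξ + ∑ j ∈ S n (-1), B n j ξ) := funext hΩ
      rw [hΩfun]
      refine (hJd ξ).hasDerivAt.add (HasDerivAt.const_mul 10 ?_)
      refine HasDerivAt.fun_sum fun n hn => ?_
      exact (HasDerivAt.fun_sum fun j _ => ((hBfacts n hn j).1 ξ).hasDerivAt).add
        (HasDerivAt.fun_sum fun j _ => ((hBfacts n hn j).1 ξ).hasDerivAt)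
    have hdiff : Differentiable ℝ Ω := fun ξ => (hderiv ξ).differentiableAt
    -- per generation: at most `6K`, and zero unless `n < 16` or `ξ` is in the window of `n`
    have hgenbd : ∀ ξ, ∀ n ∈ 𝒩,
        |∑ j ∈ S n 1, deriv (B n j) ξ + ∑ j ∈ S n (-1), deriv (B n j) ξ| ≤ 6 * K := by
      intro ξ n hn
      have h1 := sum_abs_deriv_cutoff_le hχd hχ0 hχ1 hχone hχzero hK0 hK
        (hρpos n (h𝒩mem n hn).1) (S n 1) ξ
      have h2 := sum_abs_deriv_cutoff_le hχd hχ0 hχ1 hχone hχzero hK0 hK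
        (hρpos n (h𝒩mem n hn).1) (S n (-1)) ξ
      simp only [← hBfun] at h1 h2
      calc |∑ j ∈ S n 1, deriv (B n j) ξ + ∑ j ∈ S n (-1), deriv (B n j) ξ|
          ≤ |∑ j ∈ S n 1, deriv (B n j) ξ| + |∑ j ∈ S n (-1), deriv (B n j) ξ| := abs_add_le _ _
        _ ≤ ∑ j ∈ S n 1, |deriv (B n j) ξ| + ∑ j ∈ S n (-1), |deriv (B n j) ξ| :=
            add_le_add (Finset.abs_sum_le_sum_abs _ _) (Finset.abs_sum_le_sum_abs _ _)
        _ ≤ 3 * K + 3 * K := add_le_add h1 h2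
        _ = 6 * K := by ring
    have hgenzero : ∀ ξ, ∀ n ∈ 𝒩, ¬ (n < 16 ∨ ((2 : ℝ) ^ n / 2 ≤ |ξ| ∧ |ξ| < 2 ^ n * 4)) →
        ∑ j ∈ S n 1, deriv (B n j) ξ + ∑ j ∈ S n (-1), deriv (B n j) ξ = 0 := by
      intro ξ n hn hno
      push Not at hno
      obtain ⟨h16, hnotwin⟩ := hno
      have h16' : 16 ≤ n := Nat.le_of_not_lt (by omega)
      have hz : ∀ σ : ℝ, σ = 1 ∨ σ = -1 → ∑ j ∈ S n σ, deriv (B n j) ξ = 0 := by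
        intro σ hσ
        refine Finset.sum_eq_zero fun j hj => ?_
        have hfar : ρ n < |ξ - (j + 1 / 2) * ρ n| := by
          by_contra hle
          push Not at hle
          have hw := (hS n σ ⟨(h𝒩mem n hn).1, (h𝒩mem n hn).2, hσ⟩).2.2 h16' j hj ξ hle
          exact absurd hw.2 (not_lt.2 (hnotwin hw.1))
        rw [hBfun]
        exact deriv_cutoff_eq_zero_of_far hχd hχ0 hχ1 hχone hχzero hK
          (hρpos n (h𝒩mem n hn).1) _ hfar
      rw [hz 1 (Or.inl rfl), hz (-1) (Or.inr rfl), add_zero]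
    -- counting the active generations
    have hcount : ∀ ξ, ((𝒩.filter fun n => n < 16 ∨
        ((2 : ℝ) ^ n / 2 ≤ |ξ| ∧ |ξ| < 2 ^ n * 4)).card : ℝ) ≤ 18 := by
      intro ξ
      rw [Finset.filter_or]
      have h1 : (𝒩.filter fun n => n < 16).card ≤ 15 := by
        have hsub : (𝒩.filter fun n => n < 16) ⊆ Finset.Icc 1 15 := by
          intro n hn
          rw [Finset.mem_filter] at hn
          rw [Finset.mem_Icc]
          exact ⟨(h𝒩mem n hn.1).1, by omega⟩
        exact (Finset.card_le_card hsub).trans (by rw [Nat.card_Icc])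
      have h2 := card_filter_dyadic_le_three 𝒩 ξ
      have h3 := Finset.card_union_le (𝒩.filter fun n => n < 16)
        (𝒩.filter fun n => (2 : ℝ) ^ n / 2 ≤ |ξ| ∧ |ξ| < 2 ^ n * 4)
      have : ((𝒩.filter fun n => n < 16) ∪
          (𝒩.filter fun n => (2 : ℝ) ^ n / 2 ≤ |ξ| ∧ |ξ| < 2 ^ n * 4)).card ≤ 18 := by omega
      exact_mod_cast this
    have hDbound : ∀ ξ, |deriv Ω ξ| ≤ 1 + 1080 * K := by
      intro ξ
      rw [(hderiv ξ).deriv]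
      set F : ℕ → ℝ := fun n => ∑ j ∈ S n 1, deriv (B n j) ξ + ∑ j ∈ S n (-1), deriv (B n j) ξ
        with hF
      have hsplit := Finset.sum_filter_add_sum_filter_not 𝒩
        (fun n => n < 16 ∨ ((2 : ℝ) ^ n / 2 ≤ |ξ| ∧ |ξ| < 2 ^ n * 4)) F
      have hzero : ∑ n ∈ 𝒩.filter (fun n => ¬ (n < 16 ∨
          ((2 : ℝ) ^ n / 2 ≤ |ξ| ∧ |ξ| < 2 ^ n * 4))), F n = 0 :=
        Finset.sum_eq_zero fun n hn =>
          hgenzero ξ n (Finset.mem_filter.1 hn).1 (Finset.mem_filter.1 hn).2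
      have hactive : |∑ n ∈ 𝒩.filter (fun n => n < 16 ∨
          ((2 : ℝ) ^ n / 2 ≤ |ξ| ∧ |ξ| < 2 ^ n * 4)), F n| ≤ 18 * (6 * K) := by
        refine (Finset.abs_sum_le_sum_abs _ _).trans ?_
        calc ∑ n ∈ 𝒩.filter (fun n => n < 16 ∨ ((2 : ℝ) ^ n / 2 ≤ |ξ| ∧ |ξ| < 2 ^ n * 4)), |F n|
            ≤ ∑ _n ∈ 𝒩.filter (fun n => n < 16 ∨ ((2 : ℝ) ^ n / 2 ≤ |ξ| ∧ |ξ| < 2 ^ n * 4)),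
                6 * K := Finset.sum_le_sum fun n hn => hgenbd ξ n (Finset.mem_filter.1 hn).1
          _ ≤ 18 * (6 * K) := by
              rw [Finset.sum_const, nsmul_eq_mul]
              exact mul_le_mul_of_nonneg_right (hcount ξ) (by positivity)
      have hsumF : |∑ n ∈ 𝒩, F n| ≤ 108 * K := by
        rw [← hsplit, hzero, add_zero]; linarith
      calc |deriv (fun ξ : ℝ => 2 * (1 + ξ ^ 2) ^ (1 / 4 : ℝ)) ξ + 10 * ∑ n ∈ 𝒩, F n|
          ≤ |deriv (fun ξ : ℝ => 2 * (1 + ξ ^ 2) ^ (1 / 4 : ℝ)) ξ| + |10 * ∑ n ∈ 𝒩, F n| :=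
            abs_add_le _ _
        _ ≤ 1 + 10 * (108 * K) := by
            rw [abs_mul, abs_of_pos (by norm_num : (0:ℝ) < 10)]
            exact add_le_add (hJ' ξ) (by nlinarith)
        _ = 1 + 1080 * K := by ring
    -- mean value theorem
    have hlip : LipschitzWith ⟨1 + 1080 * K, by positivity⟩ Ω :=
      lipschitzWith_of_nnnorm_deriv_le hdiff fun ξ => by
        rw [← NNReal.coe_le_coe, coe_nnnorm, Real.norm_eq_abs]
        exact hDbound ξ
    have hcdΩ : ContDiff ℝ 1 Ω := by
      have hΩfun : Ω = fun ξ => 2 * (1 + ξ ^ 2) ^ (1 / 4 : ℝ) +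
          10 * ∑ n ∈ 𝒩, (∑ j ∈ S n 1, B n j ξ + ∑ j ∈ S n (-1), B n j ξ) := funext hΩ
      rw [hΩfun]
      refine contDiff_japaneseBracket_quarter.add (contDiff_const.mul ?_)
      refine ContDiff.sum fun n _ => (ContDiff.sum fun j _ => ?_).add (ContDiff.sum fun j _ => ?_) <;>
      · rw [hBfun]; exact contDiff_scaled_cutoff hχcd _ _
    refine ⟨hcdΩ, fun ξ => (hDbound ξ).trans hCL, fun ξ η => ?_⟩
    have h := hlip.dist_le_mul ξ η
    rw [Real.dist_eq, Real.dist_eq] at h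
    have h' : |Ω ξ - Ω η| ≤ (1 + 1080 * K) * |ξ - η| := h
    exact h'.trans (mul_le_mul_of_nonneg_right hCL (abs_nonneg _))
  · exact hΩint
  · ----------------------------------------------------------------
    -- the integral bound
    ----------------------------------------------------------------
    have hval : ∫ ξ, Ω ξ / (1 + ξ ^ 2) = A₀ + 10 * ∑ n ∈ 𝒩,
        ((∑ j ∈ S n 1, (∫ ξ, B n j ξ / (1 + ξ ^ 2))) + ∑ j ∈ S n (-1), (∫ ξ, B n j ξ / (1 + ξ ^ 2))) := by
      rw [show (fun ξ => Ω ξ / (1 + ξ ^ 2)) = fun ξ => 2 * (1 + ξ ^ 2) ^ (1 / 4 : ℝ) / (1 + ξ ^ 2) +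
        10 * ∑ n ∈ 𝒩, (∑ j ∈ S n 1, B n j ξ / (1 + ξ ^ 2) +
          ∑ j ∈ S n (-1), B n j ξ / (1 + ξ ^ 2)) from funext hΩdiv,
        integral_add hJint (hrest.const_mul 10), integral_const_mul, hA₀]
      congr 2
      rw [integral_finsetSum 𝒩 (f := fun n a => ∑ j ∈ S n 1, B n j a / (1 + a ^ 2) +
          ∑ j ∈ S n (-1), B n j a / (1 + a ^ 2)) fun n hn =>
        (integrable_finsetSum _ fun j hj => (hgenint n hn 1 (Or.inl rfl)).1 j hj).add
          (integrable_finsetSum _ fun j hj => (hgenint n hn (-1) (Or.inr rfl)).1 j hj)]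
      refine Finset.sum_congr rfl fun n hn => ?_
      rw [integral_add (integrable_finsetSum _ fun j hj => (hgenint n hn 1 (Or.inl rfl)).1 j hj)
        (integrable_finsetSum _ fun j hj => (hgenint n hn (-1) (Or.inr rfl)).1 j hj),
        integral_finsetSum _ fun j hj => (hgenint n hn 1 (Or.inl rfl)).1 j hj,
        integral_finsetSum _ fun j hj => (hgenint n hn (-1) (Or.inr rfl)).1 j hj]
    rw [hval]
    -- bound the generation sums
    set G : ℕ → ℝ := fun n =>
      (∑ j ∈ S n 1, (∫ ξ, B n j ξ / (1 + ξ ^ 2))) + ∑ j ∈ S n (-1), (∫ ξ, B n j ξ / (1 + ξ ^ 2)) with hG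
    have hGsmall : ∀ n ∈ 𝒩, n < 16 → G n ≤ 360 * 2 ^ 30 * C_R ^ 2 := by
      intro n hn h16
      have h1 := (hgenint n hn 1 (Or.inl rfl)).2.1 h16
      have h2 := (hgenint n hn (-1) (Or.inr rfl)).2.1 h16
      show (∑ j ∈ S n 1, (∫ ξ, B n j ξ / (1 + ξ ^ 2))) + ∑ j ∈ S n (-1), (∫ ξ, B n j ξ / (1 + ξ ^ 2)) ≤ _
      calc (∑ j ∈ S n 1, (∫ ξ, B n j ξ / (1 + ξ ^ 2))) + ∑ j ∈ S n (-1), (∫ ξ, B n j ξ / (1 + ξ ^ 2))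
          ≤ 180 * 2 ^ 30 * C_R ^ 2 + 180 * 2 ^ 30 * C_R ^ 2 := add_le_add h1 h2
        _ = 360 * 2 ^ 30 * C_R ^ 2 := by ring
    have hGlarge : ∀ n ∈ 𝒩, ¬ n < 16 → G n ≤ 96 * C_R ^ 2 * (n : ℝ) ^ (-p) := by
      intro n hn h16
      have h16' : 16 ≤ n := Nat.le_of_not_lt h16
      have h1 := (hgenint n hn 1 (Or.inl rfl)).2.2 h16'
      have h2 := (hgenint n hn (-1) (Or.inr rfl)).2.2 h16'
      have hpn : (n : ℝ) ^ (-((1 + δ) / 2 * (2 - δ))) = (n : ℝ) ^ (-p) := by rw [hp]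
      rw [hpn] at h1 h2
      show (∑ j ∈ S n 1, (∫ ξ, B n j ξ / (1 + ξ ^ 2))) + ∑ j ∈ S n (-1), (∫ ξ, B n j ξ / (1 + ξ ^ 2)) ≤ _
      calc (∑ j ∈ S n 1, (∫ ξ, B n j ξ / (1 + ξ ^ 2))) + ∑ j ∈ S n (-1), (∫ ξ, B n j ξ / (1 + ξ ^ 2))
          ≤ 48 * C_R ^ 2 * (n : ℝ) ^ (-p) + 48 * C_R ^ 2 * (n : ℝ) ^ (-p) := add_le_add h1 h2
        _ = 96 * C_R ^ 2 * (n : ℝ) ^ (-p) := by ring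
    have hsplit := Finset.sum_filter_add_sum_filter_not 𝒩 (fun n => n < 16) G
    have hpart1 : ∑ n ∈ 𝒩.filter (fun n => n < 16), G n ≤ 2700 * 2 ^ 31 * C_R ^ 2 := by
      have hcard : ((𝒩.filter fun n => n < 16).card : ℝ) ≤ 15 := by
        have hsub : (𝒩.filter fun n => n < 16) ⊆ Finset.Icc 1 15 := by
          intro n hn
          rw [Finset.mem_filter] at hn
          rw [Finset.mem_Icc]
          exact ⟨(h𝒩mem n hn.1).1, by omega⟩
        have := (Finset.card_le_card hsub).trans (by rw [Nat.card_Icc] : (Finset.Icc 1 15).card ≤ 15)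
        exact_mod_cast this
      calc ∑ n ∈ 𝒩.filter (fun n => n < 16), G n
          ≤ ∑ _n ∈ 𝒩.filter (fun n => n < 16), 360 * 2 ^ 30 * C_R ^ 2 :=
            Finset.sum_le_sum fun n hn =>
              hGsmall n (Finset.mem_filter.1 hn).1 (Finset.mem_filter.1 hn).2
        _ = (𝒩.filter fun n => n < 16).card * (360 * 2 ^ 30 * C_R ^ 2) := by
            rw [Finset.sum_const, nsmul_eq_mul]
        _ ≤ 15 * (360 * 2 ^ 30 * C_R ^ 2) :=
            mul_le_mul_of_nonneg_right hcard (by positivity)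
        _ = 2700 * 2 ^ 31 * C_R ^ 2 := by ring
    have hpart2 : ∑ n ∈ 𝒩.filter (fun n => ¬ n < 16), G n ≤ 96 * C_R ^ 2 * Z := by
      have hterm : ∀ n : ℕ, 0 ≤ (n : ℝ) ^ (-p) := fun n => Real.rpow_nonneg (Nat.cast_nonneg n) _
      calc ∑ n ∈ 𝒩.filter (fun n => ¬ n < 16), G n
          ≤ ∑ n ∈ 𝒩.filter (fun n => ¬ n < 16), 96 * C_R ^ 2 * (n : ℝ) ^ (-p) :=
            Finset.sum_le_sum fun n hn =>
              hGlarge n (Finset.mem_filter.1 hn).1 (Finset.mem_filter.1 hn).2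
        _ = 96 * C_R ^ 2 * ∑ n ∈ 𝒩.filter (fun n => ¬ n < 16), (n : ℝ) ^ (-p) := by
            rw [Finset.mul_sum]
        _ ≤ 96 * C_R ^ 2 * Z := by
            refine mul_le_mul_of_nonneg_left ?_ (by positivity)
            exact hsum.sum_le_tsum _ (fun n _ => hterm n)
    have htotal : ∑ n ∈ 𝒩, G n ≤ 2700 * 2 ^ 31 * C_R ^ 2 + 96 * C_R ^ 2 * Z := by
      rw [← hsplit]; linarith
    calc A₀ + 10 * ∑ n ∈ 𝒩, G n ≤ A₀ + 10 * (2700 * 2 ^ 31 * C_R ^ 2 + 96 * C_R ^ 2 * Z) := by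
          linarith
      _ ≤ C₀ := hCI
  · ----------------------------------------------------------------
    -- the lower bound on `Y`
    ----------------------------------------------------------------
    intro ξ hξY
    have hξα : |ξ| ≤ α₁ := abs_le.2 ⟨by linarith [(hYsub hξY).1], (hYsub hξY).2⟩
    by_cases hsmall : |ξ| < 2
    · -- `θ ≤ 1`, `|ξ| < 2`, `Ω ≥ 2`
      have hθ1 : Real.log (10 + |ξ|) ^ (-(1 + δ) / 2) ≤ 1 := by
        apply Real.rpow_le_one_of_one_le_of_nonpos ?_ (by linarith)
        rw [Real.le_log_iff_exp_le (by positivity)]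
        have := Real.exp_one_lt_d9
        linarith [abs_nonneg ξ]
      have h1 : (1 : ℝ) ≤ (1 + ξ ^ 2) ^ (1 / 4 : ℝ) := Real.one_le_rpow (by nlinarith) (by norm_num)
      calc Real.log (10 + |ξ|) ^ (-(1 + δ) / 2) * |ξ| ≤ 1 * 2 :=
            mul_le_mul hθ1 hsmall.le (abs_nonneg _) zero_le_one
        _ ≤ 2 * (1 + ξ ^ 2) ^ (1 / 4 : ℝ) := by linarith
        _ ≤ Ω ξ := hlower ξ
    · push Not at hsmall
      -- the dyadic generation of `ξ`
      set N : ℕ := ⌊|ξ|⌋₊ with hN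
      have hN2 : 2 ≤ N := Nat.le_floor (by exact_mod_cast hsmall)
      set n : ℕ := Nat.log 2 N with hn
      have hn1 : 1 ≤ n := Nat.log_pos one_lt_two hN2
      have hpowN : 2 ^ n ≤ N := Nat.pow_log_le_self 2 (by omega)
      have hNlt : N < 2 ^ (n + 1) := Nat.lt_pow_succ_log_self one_lt_two N
      have h2n : (2 : ℝ) ^ n ≤ |ξ| := by
        have h1 : ((2 : ℝ) ^ n) ≤ N := by exact_mod_cast hpowN
        exact h1.trans (Nat.floor_le (abs_nonneg ξ))
      have h2n1 : |ξ| < 2 ^ (n + 1) := by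
        have h1 : |ξ| < N + 1 := Nat.lt_floor_add_one |ξ|
        have h2 : ((N : ℝ) + 1) ≤ 2 ^ (n + 1) := by exact_mod_cast hNlt
        linarith
      have hnα : (2 : ℝ) ^ n ≤ α₁ := h2n.trans hξα
      have hn𝒩 : n ∈ 𝒩 := by
        rw [h𝒩, Finset.mem_filter, Finset.mem_range]
        refine ⟨?_, hn1, hnα⟩
        have h1 : (n : ℝ) ≤ 2 ^ n := by exact_mod_cast (Nat.lt_two_pow_self (n := n)).le
        exact Nat.lt_succ_of_le (Nat.le_floor (h1.trans hnα))
      -- the cell of `ξ`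
      have hσ : ∃ σ : ℝ, (σ = 1 ∨ σ = -1) ∧ (2 : ℝ) ^ n ≤ σ * ξ ∧ σ * ξ ≤ 2 ^ (n + 1) := by
        rcases le_or_gt 0 ξ with hξ0 | hξ0
        · refine ⟨1, Or.inl rfl, ?_, ?_⟩ <;> rw [one_mul, ← abs_of_nonneg hξ0]
          · exact h2n
          · exact h2n1.le
        · refine ⟨-1, Or.inr rfl, ?_, ?_⟩ <;> rw [neg_one_mul, ← abs_of_neg hξ0]
          · exact h2n
          · exact h2n1.le
      obtain ⟨σ, hσ1, hσa, hσb⟩ := hσ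
      obtain ⟨j, hj, hjξ⟩ := (hS n σ ⟨hn1, hnα, hσ1⟩).2.1 ξ hξY hσa hσb
      have hBval : B n j ξ = ρ n := (hBfacts n hn𝒩 j).2.2.1 ξ hjξ
      have hnn : ∀ m ∈ 𝒩, ∀ i : ℤ, 0 ≤ B m i ξ := fun m hm i => (hBfacts m hm i).2.1 ξ
      -- `Ω ξ ≥ 10 B n j ξ = 10 ρ_n`
      have hgen_ge : B n j ξ ≤ ∑ i ∈ S n 1, B n i ξ + ∑ i ∈ S n (-1), B n i ξ := by
        rcases hσ1 with rfl | rfl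
        · exact le_add_of_le_of_nonneg
            (Finset.single_le_sum (fun i _ => hnn n hn𝒩 i) hj) (Finset.sum_nonneg fun i _ => hnn n hn𝒩 i)
        · exact le_add_of_nonneg_of_le (Finset.sum_nonneg fun i _ => hnn n hn𝒩 i)
            (Finset.single_le_sum (fun i _ => hnn n hn𝒩 i) hj)
      have hsum_ge : ∑ i ∈ S n 1, B n i ξ + ∑ i ∈ S n (-1), B n i ξ ≤
          ∑ m ∈ 𝒩, (∑ i ∈ S m 1, B m i ξ + ∑ i ∈ S m (-1), B m i ξ) :=
        Finset.single_le_sum (f := fun m => ∑ i ∈ S m 1, B m i ξ + ∑ i ∈ S m (-1), B m i ξ)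
          (fun m hm => add_nonneg (Finset.sum_nonneg fun i _ => hnn m hm i)
            (Finset.sum_nonneg fun i _ => hnn m hm i)) hn𝒩
      have hΩge : 10 * ρ n ≤ Ω ξ := by
        rw [hΩ, ← hBval]
        have hJ0 : 0 ≤ 2 * (1 + ξ ^ 2) ^ (1 / 4 : ℝ) := by positivity
        linarith
      -- `θ(ξ)|ξ| ≤ 4 ρ_n`
      have hθ := theta_mul_le_dyadic (s := (1 + δ) / 2) (by linarith) (by linarith) hn1 h2n h2n1
      have hθ' : Real.log (10 + |ξ|) ^ (-(1 + δ) / 2) * |ξ| ≤ 4 * ρ n := by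
        rw [hρ n, neg_div]; exact hθ
      have hρ0 := hρpos n hn1
      linarith


/-- **BD18 Lemma 3.1 (an adapted multiplier) from BD18 Lemma 2.11 (the quantitative
Beurling–Malliavin theorem)**, sorry-free glue. Lemma 2.11 is taken as the hypothesis `h211`,
stated for weights `ω = e^{-Ω}` exactly as printed: for all `C₀, c₀ > 0` there is
`c = c(C₀, c₀) > 0` such that every `C¹` weight exponent `Ω ≥ 0` with `|Ω'| ≤ C₀` and
`∫ Ω/(1+ξ²) ≤ C₀` ((2.6)–(2.7)) admits `ψ ∈ L¹ ∩ L²`, `supp ψ ⊂ [-c₀, c₀]`, `|ψ̂| ≤ ω^c`,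
`‖ψ̂‖_{L²(-1,1)} ≥ c` ((2.8)). Conclusion = Lemma 3.1: for `0 < δ < 1`, `C_R ≥ 1`, `c₁ > 0`
there is `c₂ = c₂(δ, C_R, c₁) > 0` such that every `Y ⊂ [-α₁, α₁]`, `δ`-regular with constant
`C_R` on scales `2` to `α₁`, carries `ψ ∈ L¹ ∩ L²` with (3.2) `supp ψ ⊂ [-c₁/10, c₁/10]`,
(3.3) `‖ψ̂‖_{L²([-1,1])} ≥ c₂`, (3.4) `|ψ̂(ξ)| ≤ exp(-c₂⟨ξ⟩^{1/2})`, and (3.5)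
`|ψ̂(ξ)| ≤ exp(-c₂ θ(ξ)|ξ|)` on `Y`, `θ(ξ) = log(10+|ξ|)^{-(1+δ)/2}`. The proof is the printed
one: apply `h211` to the weight of `exists_adapted_weight`. (Lemma 2.11 itself rests on the
Beurling–Malliavin multiplier theorem, BD18 Theorem 5, which is not available in Mathlib.)
[cite: BourgainDyatlov2018, Lemma 3.1] -/
theorem adapted_multiplier_of_quantitativeBM {δ C_R c₁ : ℝ} (hδ0 : 0 < δ) (hδ1 : δ < 1)
    (hC : 1 ≤ C_R) (hc₁ : 0 < c₁)
    (h211 : ∀ C₀ c₀ : ℝ, 0 < C₀ → 0 < c₀ → ∃ c : ℝ, 0 < c ∧ ∀ Ω : ℝ → ℝ,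
      ContDiff ℝ 1 Ω → (∀ ξ, 0 ≤ Ω ξ) → (∀ ξ, |deriv Ω ξ| ≤ C₀) →
      Integrable (fun ξ => Ω ξ / (1 + ξ ^ 2)) → ∫ ξ, Ω ξ / (1 + ξ ^ 2) ≤ C₀ →
      ∃ ψ : ℝ → ℂ, Integrable ψ ∧ MemLp ψ 2 volume ∧ (∀ x, c₀ < |x| → ψ x = 0) ∧
        (∀ ξ, ‖(𝓕 ψ : ℝ → ℂ) ξ‖ ≤ Real.exp (-(c * Ω ξ))) ∧
        c ^ 2 ≤ ∫ ξ in Icc (-1 : ℝ) 1, ‖(𝓕 ψ : ℝ → ℂ) ξ‖ ^ 2) :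
    ∃ c₂ : ℝ, 0 < c₂ ∧ ∀ (α₁ : ℝ) (Y : Set ℝ), Y ⊆ Icc (-α₁) α₁ → IsRegularSet Y δ C_R 2 α₁ →
      ∃ ψ : ℝ → ℂ, Integrable ψ ∧ MemLp ψ 2 volume ∧ (∀ x, c₁ / 10 < |x| → ψ x = 0) ∧
        c₂ ^ 2 ≤ ∫ ξ in Icc (-1 : ℝ) 1, ‖(𝓕 ψ : ℝ → ℂ) ξ‖ ^ 2 ∧
        (∀ ξ, ‖(𝓕 ψ : ℝ → ℂ) ξ‖ ≤ Real.exp (-(c₂ * (1 + ξ ^ 2) ^ (1 / 4 : ℝ)))) ∧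
        ∀ ξ ∈ Y, ‖(𝓕 ψ : ℝ → ℂ) ξ‖ ≤
          Real.exp (-(c₂ * (Real.log (10 + |ξ|) ^ (-(1 + δ) / 2) * |ξ|))) := by
  obtain ⟨C₀, hC₀, hweight⟩ := exists_adapted_weight hδ0 hδ1 hC
  obtain ⟨c, hc, hmult⟩ := h211 C₀ (c₁ / 10) hC₀ (by positivity)
  refine ⟨c, hc, fun α₁ Y hYsub hY => ?_⟩
  obtain ⟨Ω, hΩlow, ⟨hΩcd, hΩderiv, -⟩, hΩint, hΩle, hΩY⟩ := hweight α₁ Y hYsub hY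
  have hΩnn : ∀ ξ, 0 ≤ Ω ξ := fun ξ => le_trans (by positivity) (hΩlow ξ)
  obtain ⟨ψ, hψ1, hψ2, hψsupp, hψbd, hψL2⟩ := hmult Ω hΩcd hΩnn hΩderiv hΩint hΩle
  refine ⟨ψ, hψ1, hψ2, hψsupp, hψL2, fun ξ => (hψbd ξ).trans ?_, fun ξ hξ => (hψbd ξ).trans ?_⟩
  · rw [Real.exp_le_exp]
    have h1 : (1 + ξ ^ 2) ^ (1 / 4 : ℝ) ≤ Ω ξ := le_trans (by
      linarith [Real.rpow_nonneg (show (0:ℝ) ≤ 1 + ξ ^ 2 by positivity) (1 / 4 : ℝ)]) (hΩlow ξ)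
    nlinarith
  · rw [Real.exp_le_exp]
    have h1 := hΩY ξ hξ
    nlinarith

end Literature.Analysis.Fourier
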